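import Literature.NumberTheory.Sieve.GrimmeltMerikoski2025LevelMultiplicity
import Literature.NumberTheory.Sieve.GrimmeltMerikoski2025KernelDiagonal
import HarnessLib

/-!
# Grimmelt–Merikoski 2025, Proposition 4.1 (Heegner-point kernels) in arithmetic form

L. Grimmelt, J. Merikoski, *On the greatest prime factor and uniform equidistribution of quadratic
polynomials*, arXiv:2505.00493 [GrimmeltMerikoski2025], §4.1.  In the proof of the Type I
estimate (Theorem 1.4, the named fact
`Literature.NumberTheory.Sieve.grimmeltMerikoski2025_thm14_restricted`) §5 of the paper bounds the
second kernel quantity `K₂ = ∑_{d ≤ D} ⟨α_{d,a,h}|Δ_{ad} k_{Z₂²,1}|α_{d,a,h}⟩ ≤ ∑_{q ≤ aD} ⟨α_q|𝒦_q k|α_q⟩`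
by Proposition 4.1: `∑_{q ∼ Q} ⟨α_q|𝒦_q k_{Z,1}|α_q⟩ ≺≺ Q h^{1/2} + h Z^{1/2}`, where
`α_q` is the functional of the Heegner points `Λ_h` twisted by the level condition
`𝔠(τσ) ≡ 0 (mod q)`.  The first display of the printed proof rewrites
`⟨α_q|𝒦_q k|α_q⟩ = ∑_{z₂ ∈ Λ_h} ∑_{w₁ ∈ 𝒮_h} k(u(w₁, z₂)) ∑_{τ ∈ T_q} α_q(τw₁) α_q(τz₂)`
(up to the weights `|Γ_z|⁻¹ ≤ 1`); everything after that is elementary counting, and this file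
PROVES it, in arithmetic form, for the majorant kernel `k⁺_Z(u) = 𝟙{u ≤ Z}/√(1 + u)`
(`GM2025.kPlus`) and with the multiplicity `∑_τ α_q(τw₁)α_q(τz₂)` replaced by the explicit upper
bound `levelWeight q s t` (zero unless `s = t` or `q ∣ Res(s, t)`, and then the level-coset bound
`levelMultBound` of `GrimmeltMerikoski2025LevelMultiplicity.lean`); the identification with the
functional of §5 is the assembly layer's business.

Forms of discriminant `−4h` with positive first coefficient are pairs `(A, B)`, `4A ∣ B² + 4h`,
`C = (B² + 4h)/(4A)` (`formC`), with Heegner point `z = (−B + i√(4h))/(2A)`: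

* `uPair h s t` — the point-pair invariant `u(z_s, z_t) = ((BA' − B'A)² + 4h(A' − A)²)/(16hAA')`
  ([GrimmeltMerikoski2025, §4.1.2, display for `u(w₁, z₂)`], there with `(𝔟, 𝔠) = (−B/2, A)`),
  its support consequences `sq_le_of_uPair_le`, `fst_le_of_uPair_le` ("`𝔠₁ ≪ Z𝔠₂`",
  "`|𝔟₁| ≪ Z√h`") and the weight `kPlus_uPair_le_of_lt` (`≤ 2√(AA')/(A − A')`);
* `rowSum`, `card_row_support_le`, `rowSum_le`, `rowSum_le_of_lt`, `sum_rowSum_near_le`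
  (`𝔠₁ ≤ 10𝔠₂`), `sum_rowSum_far_le` (`𝔠₁ > 10𝔠₂`) — the counting of §4.1.2, with the root
  counts `ρ(1, 0, ah₀; A) ≤ 4^{ω(A)} a` (`rho_one_le`) from `quadRootCount_le_of_gcd_of_sq`;
* `discPairs` (all forms in a box, `𝒮_h`), `heegnerReps` (the reduced forms `|B| ≤ A ≤ C`,
  `Λ_h`, (3.2)) with `card_heegnerReps_le` ("`#Λ_h ≤ h^{1/2+o(1)}`");
* `resPair` and `res_identity`: `16A²A'² Res = N(N + 16hAA')` with `N = 16hAA'·u`, hence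
  `Res > 0` off the diagonal (`resPair_pos`, the paper's "`F(w₁, z₂) ≠ 0` for `w₁ ≠ z₂`") and
  `Res ≤ 16h²Z(Z+1)` on the support (`resPair_le`), so that the divisor bound absorbs the sum over
  `q ∣ Res` (§4.1.2);
* `levelMultBound`, `levelMultBound_le` (`≤ τ(q) 4^{ω(q)} a²`), `levelWeight`,
  `sum_levelWeight_le` (diagonal `× Q`, off-diagonal `× τ(Res)`);
* **`heegnerKernel_sum_le_explicit`**, **`heegnerKernel_sum_le`** — Proposition 4.1 in
  arithmetic form: for every `ε > 0` there is `K` with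
  `∑_{q ≤ Q} ∑_{t ∈ Λ_h} ∑_{s ∈ 𝒮_h ∩ box} k⁺_Z(u(s,t)) levelWeight(q,s,t) ≤ K a⁴ (hQZ)^ε (Q h^{1/2} + h Z^{1/2})`
  for all `h = ah₀` (`h₀` square-free, `gcd(a, h₀) = 1` — the paper's hypothesis
  "`gcd(h, q²)` square-free" holds for ALL `q` exactly when `a` is square-free; in §5 the
  determinant is `ah` with `a ≺≺ 1` arbitrary, so the dependence on `a` is kept explicit instead),
  `Q, Z ≥ 1`, uniformly in the box.

Everything is elementary and proved; nothing is vendored; no fact is introduced.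

## References

* [GrimmeltMerikoski2025] arXiv:2505.00493, §3.1 ((3.2), `Λ_h`, `#Λ_h ≤ h^{1/2+o(1)}`),
  Proposition 4.1 and its proof §4.1.1 (diagonal) – §4.1.2 (off-diagonal), §5 ((K2bound)).
-/

noncomputable section

namespace Literature.NumberTheory.Sieve

open Finset
open Literature.NumberTheory.QuadraticFields.Quadratic (BinQF)
open scoped MatrixGroups

namespace GM2025

/-! ## Proposition 4.1 (Heegner-point kernels): the counting in arithmetic form

Forms of discriminant `−4h` with `A > 0` are recorded by the pair `(A, B)` (`C = (B² + 4h)/(4A)`,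
`4A ∣ B² + 4h`); the Heegner point is `z = (−B + i√(4h))/(2A)` and the point-pair invariant of
two such points is `uPair h (A, B) (A', B')`.
-/

section heegnerCounting

/-- Members of a residue class modulo `A ≥ 1` in an integer window of length `W`:
`#{b ∈ [m, m + W] : A ∣ b − ν} ≤ W/A + 1`. [folklore] -/
theorem card_Icc_filter_dvd_sub_le' {A : ℕ} (hA : 0 < A) (m : ℤ) (W : ℕ) (ν : ℤ) :
    #((Icc m (m + W)).filter (fun b : ℤ => (A : ℤ) ∣ b - ν)) ≤ W / A + 1 := by
  have hAz : (0 : ℤ) < A := by exact_mod_cast hA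
  set S := (Icc m (m + W)).filter (fun b : ℤ => (A : ℤ) ∣ b - ν) with hS
  have hmaps : ∀ b ∈ S, ((b - m) / A).toNat ∈ range (W / A + 1) := by
    intro b hb
    rw [hS, mem_filter, mem_Icc] at hb
    rw [mem_range, Nat.lt_succ_iff]
    have h0 : 0 ≤ (b - m) / A := Int.ediv_nonneg (by linarith [hb.1.1]) hAz.le
    have h1 : (b - m) / A ≤ (W : ℤ) / A := Int.ediv_le_ediv hAz (by linarith [hb.1.2])
    have h2 : ((W : ℤ) / A) = ((W / A : ℕ) : ℤ) := by simp
    zify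
    rw [Int.toNat_of_nonneg h0]
    rw [h2] at h1
    exact h1
  have hinj : Set.InjOn (fun b : ℤ => ((b - m) / A).toNat) ↑S := by
    intro b hb b' hb' hbb'
    rw [mem_coe, hS, mem_filter, mem_Icc] at hb hb'
    simp only at hbb'
    have h0 : 0 ≤ (b - m) / A := Int.ediv_nonneg (by linarith [hb.1.1]) hAz.le
    have h0' : 0 ≤ (b' - m) / A := Int.ediv_nonneg (by linarith [hb'.1.1]) hAz.le
    have heq : (b - m) / A = (b' - m) / A := by
      have := congrArg (fun n : ℕ => (n : ℤ)) hbb'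
      simpa only [Int.toNat_of_nonneg h0, Int.toNat_of_nonneg h0'] using this
    -- `A ∣ b - b'` and `|b - b'| < A`
    have hdvd : (A : ℤ) ∣ b - b' := by
      have := dvd_sub hb.2 hb'.2; rwa [sub_sub_sub_cancel_right] at this
    have hlt : |b - b'| < A := by
      have e1 := Int.emod_add_mul_ediv (b - m) A
      have e2 := Int.emod_add_mul_ediv (b' - m) A
      have r1 := Int.emod_nonneg (b - m) hAz.ne'
      have r2 := Int.emod_nonneg (b' - m) hAz.ne'
      have r3 := Int.emod_lt_of_pos (b - m) hAz
      have r4 := Int.emod_lt_of_pos (b' - m) hAz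
      rw [heq] at e1
      rw [abs_sub_lt_iff]; constructor <;> nlinarith
    exact Int.eq_of_sub_eq_zero (Int.eq_zero_of_abs_lt_dvd hdvd hlt)
  calc #S ≤ #(range (W / A + 1)) := card_le_card_of_injOn _ hmaps hinj
    _ = W / A + 1 := card_range _

/-- **Roots of `b² + h ≡ 0 (mod A)` in a window**: `#{b ∈ [m, m + W] : A ∣ b² + h} ≤ (W/A + 1) ρ(1, 0, h; A)`.
[folklore] -/
theorem card_window_sq_le (h : ℤ) {A : ℕ} (hA : 0 < A) (m : ℤ) (W : ℕ) :
    #((Icc m (m + W)).filter (fun b : ℤ => (A : ℤ) ∣ b ^ 2 + h)) ≤ (W / A + 1) * quadRootCount 1 0 h A := by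
  set s := (Icc m (m + W)).filter (fun b : ℤ => (A : ℤ) ∣ b ^ 2 + h) with hs
  set f : ℤ → ℕ := fun b => (b % (A : ℤ)).toNat with hf_def
  have hAz : (0 : ℤ) < A := by exact_mod_cast hA
  have hf : ∀ b, ((f b : ℕ) : ℤ) = b % (A : ℤ) := fun b =>
    Int.toNat_of_nonneg (Int.emod_nonneg _ hAz.ne')
  have h1 : #s ≤ (W / A + 1) * #(s.image f) := by
    refine card_le_mul_card_image s _ fun ν _ => ?_
    calc #(s.filter fun b => f b = ν) ≤ #((Icc m (m + W)).filter (fun b : ℤ => (A : ℤ) ∣ b - (ν : ℤ))) := by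
          refine card_le_card fun b hb => ?_
          obtain ⟨hbs, hfb⟩ := mem_filter.mp hb
          refine mem_filter.mpr ⟨(mem_filter.mp hbs).1, ?_⟩
          rw [← hfb, hf b, Int.emod_def]
          exact ⟨b / A, by ring⟩
      _ ≤ W / A + 1 := card_Icc_filter_dvd_sub_le' hA m W ν
  have h2 : s.image f ⊆ (range A).filter (fun x : ℕ => (A : ℤ) ∣ 1 * (x : ℤ) ^ 2 + 0 * x + h) := by
    intro ν hν
    obtain ⟨b, hb, rfl⟩ := mem_image.mp hν
    obtain ⟨-, hdvd⟩ := mem_filter.mp hb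
    refine mem_filter.mpr ⟨mem_range.mpr ?_, ?_⟩
    · have : ((f b : ℕ) : ℤ) < A := by rw [hf]; exact Int.emod_lt_of_pos _ hAz
      exact_mod_cast this
    · rw [hf b, one_mul, zero_mul, add_zero]
      have e : (b % (A : ℤ)) ^ 2 + h = (b ^ 2 + h) - (A : ℤ) * ((b / A) * (2 * b - A * (b / A))) := by
        rw [Int.emod_def]; ring
      rw [e]
      exact dvd_sub hdvd (dvd_mul_right _ _)
  calc #s ≤ (W / A + 1) * #(s.image f) := h1
    _ ≤ (W / A + 1) * quadRootCount 1 0 h A := by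
        unfold quadRootCount; exact Nat.mul_le_mul_left _ (card_le_card h2)

/-- The point-pair invariant of the Heegner points `(−B + i√(4h))/(2A)`, `(−B' + i√(4h))/(2A')`:
`u = ((BA' − B'A)² + 4h(A' − A)²) / (16 h A A')`. [cite: GrimmeltMerikoski2025, §4.1.2 (display for u(w₁, z₂))] -/
def uPair (h : ℕ) (s t : ℤ × ℤ) : ℝ :=
  (((s.2 * t.1 - t.2 * s.1 : ℤ) : ℝ) ^ 2 + 4 * (h : ℝ) * ((t.1 - s.1 : ℤ) : ℝ) ^ 2) /
    (16 * (h : ℝ) * s.1 * t.1)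

/-- `u ≥ 0` for `A, A' > 0`. [folklore] -/
theorem uPair_nonneg {h : ℕ} {s t : ℤ × ℤ} (hs : 0 < s.1) (ht : 0 < t.1) : 0 ≤ uPair h s t := by
  unfold uPair
  have : (0 : ℝ) < s.1 := by exact_mod_cast hs
  have : (0 : ℝ) < t.1 := by exact_mod_cast ht
  positivity

/-- On the support `u ≤ Z`: `(BA' − B'A)² ≤ 16hZAA'` and `(A' − A)² ≤ 4ZAA'`. [cite: GrimmeltMerikoski2025, §4.1.2 ("we can restrict summation to … ≤ Z")] -/
theorem sq_le_of_uPair_le {h : ℕ} (hh : 0 < h) {s t : ℤ × ℤ} (hs : 0 < s.1) (ht : 0 < t.1) {Z : ℝ}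
    (hu : uPair h s t ≤ Z) :
    ((s.2 * t.1 - t.2 * s.1 : ℤ) : ℝ) ^ 2 ≤ 16 * h * Z * s.1 * t.1 ∧
      ((t.1 - s.1 : ℤ) : ℝ) ^ 2 ≤ 4 * Z * s.1 * t.1 := by
  unfold uPair at hu
  have hs' : (0 : ℝ) < s.1 := by exact_mod_cast hs
  have ht' : (0 : ℝ) < t.1 := by exact_mod_cast ht
  have hh' : (0 : ℝ) < h := by exact_mod_cast hh
  have hden : (0 : ℝ) < 16 * (h : ℝ) * s.1 * t.1 := by positivity
  rw [div_le_iff₀ hden] at hu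
  have hX := sq_nonneg (((s.2 * t.1 - t.2 * s.1 : ℤ) : ℝ))
  have hY := sq_nonneg (((t.1 - s.1 : ℤ) : ℝ))
  constructor <;> nlinarith

/-- On the support: `A ≤ (2 + 4Z)A'`. [cite: GrimmeltMerikoski2025, §4.1.2 ("𝔠₁ ≪ Z𝔠₂")] -/
theorem fst_le_of_uPair_le {h : ℕ} (hh : 0 < h) {s t : ℤ × ℤ} (hs : 0 < s.1) (ht : 0 < t.1) {Z : ℝ}
    (hu : uPair h s t ≤ Z) : (s.1 : ℝ) ≤ (2 + 4 * Z) * t.1 := by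
  obtain ⟨-, hY⟩ := sq_le_of_uPair_le hh hs ht hu
  have hs' : (0 : ℝ) < s.1 := by exact_mod_cast hs
  have ht' : (0 : ℝ) < t.1 := by exact_mod_cast ht
  push_cast at hY
  nlinarith

/-- The weight far from the diagonal: for `A > A'`,
`k⁺_Z(u) ≤ 2√(AA')/(A − A')` (`u ≥ (A − A')²/(4AA')`). [cite: GrimmeltMerikoski2025, §4.1.2 (weight 1/(1 + 𝔠₁/√(𝔠₁𝔠₂)))] -/
theorem kPlus_uPair_le_of_lt {h : ℕ} (hh : 0 < h) {s t : ℤ × ℤ} (hts : t.1 < s.1) (ht : 0 < t.1)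
    (Z : ℝ) : kPlus Z (uPair h s t) ≤ 2 * Real.sqrt ((s.1 : ℝ) * t.1) / ((s.1 : ℝ) - t.1) := by
  have hs : 0 < s.1 := ht.trans hts
  have hs' : (0 : ℝ) < s.1 := by exact_mod_cast hs
  have ht' : (0 : ℝ) < t.1 := by exact_mod_cast ht
  have hh' : (0 : ℝ) < h := by exact_mod_cast hh
  have hd : (0 : ℝ) < (s.1 : ℝ) - t.1 := by
    have : (t.1 : ℝ) < s.1 := by exact_mod_cast hts
    linarith
  have hsq : 0 < Real.sqrt ((s.1 : ℝ) * t.1) := Real.sqrt_pos.mpr (by positivity)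
  set τ : ℝ := ((s.1 : ℝ) - t.1) / Real.sqrt ((s.1 : ℝ) * t.1) with hτ
  have hτ0 : 0 < τ := div_pos hd hsq
  have hu : τ ^ 2 / 4 ≤ uPair h s t := by
    rw [hτ, div_pow, Real.sq_sqrt (by positivity)]
    unfold uPair
    rw [div_div, div_le_div_iff₀ (by positivity) (by positivity)]
    push_cast
    nlinarith [sq_nonneg (((s.2 : ℝ) * t.1 - t.2 * s.1)), mul_pos hs' ht', hh']
  calc kPlus Z (uPair h s t) ≤ 2 / τ := kPlus_le_two_div hτ0 hu
    _ = 2 * Real.sqrt ((s.1 : ℝ) * t.1) / ((s.1 : ℝ) - t.1) := by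
        rw [hτ, div_div_eq_mul_div]

/-- The row of first coefficient `A`: `∑_{|B| ≤ N', 4A ∣ B² + 4h} k⁺_Z(u((A, B), t))`. [folklore] -/
def rowSum (h : ℕ) (Z : ℝ) (t : ℤ × ℤ) (A : ℕ) (N' : ℕ) : ℝ :=
  ∑ B ∈ (Icc (-(N' : ℤ)) N').filter (fun B : ℤ => (4 * (A : ℤ)) ∣ B ^ 2 + 4 * h),
    kPlus Z (uPair h ((A : ℤ), B) t)

/-- `rowSum ≥ 0`. [folklore] -/
theorem rowSum_nonneg (h : ℕ) (Z : ℝ) (t : ℤ × ℤ) (A N' : ℕ) : 0 ≤ rowSum h Z t A N' :=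
  sum_nonneg fun _ _ => kPlus_nonneg _ _

/-- `√(xy)/y = √(x/y)` for `x ≥ 0`, `y > 0`. [folklore] -/
theorem sqrt_mul_div_eq (x : ℝ) {y : ℝ} (hy : 0 < y) :
    Real.sqrt (x * y) / y = Real.sqrt (x / y) := by
  rw [div_eq_iff hy.ne', show x / y = (x * y) / (y * y) by field_simp,
    Real.sqrt_div' _ (mul_self_nonneg y), Real.sqrt_mul_self hy.le, div_mul_cancel₀ _ hy.ne']

/-- **Counting a row on the support.**  For `A, A' ≥ 1`, `h ≥ 1`, `Z ≥ 0`: the `B` with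
`4A ∣ B² + 4h` and `u((A,B),(A',B')) ≤ Z` are even, `B = 2b` with `A ∣ b² + h` and `b` in a window
of length `≤ 4√(hZAA')/A' + 1`, hence number at most `(4√(hZ/(AA')) + 2) ρ(1,0,h; A)`.
[cite: GrimmeltMerikoski2025, §4.1.2 (the count of 𝔟₁ in blocks of length 𝔠₁)] -/
theorem card_row_support_le {h : ℕ} (hh : 0 < h) {A : ℕ} (hA : 0 < A) {t : ℤ × ℤ} (ht : 0 < t.1)
    (Z : ℝ) (N' : ℕ) :
    (#(((Icc (-(N' : ℤ)) N').filter (fun B : ℤ => (4 * (A : ℤ)) ∣ B ^ 2 + 4 * h)).filter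
        (fun B : ℤ => uPair h ((A : ℤ), B) t ≤ Z)) : ℝ) ≤
      (4 * Real.sqrt (h * Z / ((A : ℝ) * t.1)) + 2) * quadRootCount 1 0 h A := by
  have hA' : (0 : ℝ) < A := by exact_mod_cast hA
  have ht' : (0 : ℝ) < t.1 := by exact_mod_cast ht
  have hh' : (0 : ℝ) < h := by exact_mod_cast hh
  set L : ℝ := 4 * Real.sqrt (h * Z * A * t.1) with hL
  have hL0 : 0 ≤ L := by positivity
  set m : ℤ := ⌊((t.2 : ℝ) * A - L) / (2 * t.1)⌋ with hm
  set W : ℕ := ⌊L / t.1⌋₊ + 1 with hW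
  set S := ((Icc (-(N' : ℤ)) N').filter (fun B : ℤ => (4 * (A : ℤ)) ∣ B ^ 2 + 4 * h)).filter
        (fun B : ℤ => uPair h ((A : ℤ), B) t ≤ Z) with hS
  have heven : ∀ B ∈ S, (2 : ℤ) ∣ B := by
    intro B hB
    rw [hS, mem_filter, mem_filter] at hB
    have h4 : (4 : ℤ) ∣ B ^ 2 + 4 * h := (dvd_mul_right 4 (A : ℤ)).trans hB.1.2
    have h4' : (4 : ℤ) ∣ B ^ 2 := by
      have := dvd_sub h4 (dvd_mul_right 4 (h : ℤ)); rwa [add_sub_cancel_right] at this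
    exact Int.prime_two.dvd_of_dvd_pow ((show (2:ℤ) ∣ 4 by norm_num).trans h4')
  -- `B ↦ B/2` injects `S` into the window roots
  have hmaps : ∀ B ∈ S, B / 2 ∈ (Icc m (m + W)).filter (fun b : ℤ => (A : ℤ) ∣ b ^ 2 + h) := by
    intro B hB
    have h2B := heven B hB
    rw [hS, mem_filter, mem_filter] at hB
    obtain ⟨⟨_, hdvd⟩, hu⟩ := hB
    obtain ⟨b, rfl⟩ := h2B
    have hb2 : 2 * b / 2 = b := by omega
    rw [hb2, mem_filter, mem_Icc]
    refine ⟨?_, ?_⟩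
    · obtain ⟨hX, -⟩ := sq_le_of_uPair_le hh (s := ((A : ℤ), 2 * b))
        (show (0 : ℤ) < (A : ℤ) by exact_mod_cast hA) ht hu
      dsimp only at hX
      have hX' : |((2 * b * t.1 - t.2 * A : ℤ) : ℝ)| ≤ L := by
        have h1 := Real.abs_le_sqrt hX
        push_cast at h1 ⊢
        have h16 : Real.sqrt (16 * (h : ℝ) * Z * A * t.1) = L := by
          rw [hL, show (16 : ℝ) * h * Z * A * t.1 = 16 * (h * Z * A * t.1) by ring,
            Real.sqrt_mul (by norm_num), show Real.sqrt (16 : ℝ) = 4 by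
              rw [show (16 : ℝ) = 4 ^ 2 by norm_num, Real.sqrt_sq (by norm_num)]]
        rwa [h16] at h1
      rw [abs_le] at hX'
      push_cast at hX'
      obtain ⟨hX1, hX2⟩ := hX'
      have ht2 : (0 : ℝ) < 2 * t.1 := by positivity
      have hlow : ((t.2 : ℝ) * A - L) / (2 * t.1) ≤ b := by
        rw [div_le_iff₀ ht2]; linarith
      have hupp : (b : ℝ) ≤ ((t.2 : ℝ) * A - L) / (2 * t.1) + L / t.1 := by
        rw [div_add_div _ _ ht2.ne' ht'.ne', le_div_iff₀ (by positivity)]; nlinarith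
      constructor
      · have : (m : ℝ) ≤ b := (Int.floor_le _).trans hlow
        exact_mod_cast this
      · have h1 : ((t.2 : ℝ) * A - L) / (2 * t.1) < m + 1 := by
          rw [hm]; exact Int.lt_floor_add_one _
        have h2 : L / t.1 < (⌊L / t.1⌋₊ : ℝ) + 1 := Nat.lt_floor_add_one _
        have h3 : (b : ℝ) < (m : ℝ) + (W : ℝ) + 1 := by rw [hW]; push_cast; linarith
        have h4 : b < m + W + 1 := by exact_mod_cast h3
        omega
    · have : (4 * (A : ℤ)) ∣ 4 * (b ^ 2 + h) := by
        rw [show (4 : ℤ) * (b ^ 2 + h) = (2 * b) ^ 2 + 4 * h by ring]; exact hdvd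
      exact Int.dvd_of_mul_dvd_mul_left (by norm_num) this
  have hinj : Set.InjOn (fun B : ℤ => B / 2) ↑S := by
    intro B hB B' hB' hBB'
    simp only at hBB'
    obtain ⟨b, rfl⟩ := heven B hB
    obtain ⟨b', rfl⟩ := heven B' hB'
    omega
  have hcard := card_le_card_of_injOn _ hmaps hinj
  have hwin := card_window_sq_le (h : ℤ) hA m W
  have hWA : ((W / A + 1 : ℕ) : ℝ) ≤ 4 * Real.sqrt (h * Z / ((A : ℝ) * t.1)) + 2 := by
    have h1 : ((W / A : ℕ) : ℝ) ≤ (W : ℝ) / A := Nat.cast_div_le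
    have h2 : (W : ℝ) ≤ L / t.1 + 1 := by
      rw [hW]; push_cast; linarith [Nat.floor_le (show 0 ≤ L / t.1 by positivity)]
    have h3 : (W : ℝ) / A ≤ (L / t.1 + 1) / A := div_le_div_of_nonneg_right h2 hA'.le
    have h4 : (L / t.1 + 1) / A ≤ L / (A * t.1) + 1 := by
      rw [add_div, div_div, mul_comm (t.1 : ℝ) A]
      have : (1 : ℝ) / A ≤ 1 := by rw [div_le_one hA']; exact_mod_cast hA
      linarith
    have h5 : L / ((A : ℝ) * t.1) = 4 * Real.sqrt (h * Z / ((A : ℝ) * t.1)) := by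
      rw [hL, mul_div_assoc, show (h : ℝ) * Z * A * t.1 = (h * Z) * (A * t.1) by ring,
        sqrt_mul_div_eq _ (by positivity)]
    push_cast
    linarith
  calc (#S : ℝ) ≤ #((Icc m (m + W)).filter (fun b : ℤ => (A : ℤ) ∣ b ^ 2 + h)) := by exact_mod_cast hcard
    _ ≤ ((W / A + 1 : ℕ) : ℝ) * quadRootCount 1 0 h A := by exact_mod_cast hwin
    _ ≤ (4 * Real.sqrt (h * Z / ((A : ℝ) * t.1)) + 2) * quadRootCount 1 0 h A :=
        mul_le_mul_of_nonneg_right hWA (Nat.cast_nonneg _)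

/-- **Row bound, near the diagonal** (weight `≤ 1`):
`rowSum ≤ (4√(hZ/(AA')) + 2) ρ(1,0,h; A)`. [cite: GrimmeltMerikoski2025, §4.1.2 (contribution of 𝔠₁ ≤ 10𝔠₂)] -/
theorem rowSum_le {h : ℕ} (hh : 0 < h) {A : ℕ} (hA : 0 < A) {t : ℤ × ℤ} (ht : 0 < t.1)
    (Z : ℝ) (N' : ℕ) :
    rowSum h Z t A N' ≤ (4 * Real.sqrt (h * Z / ((A : ℝ) * t.1)) + 2) * quadRootCount 1 0 h A := by
  unfold rowSum
  set T := (Icc (-(N' : ℤ)) N').filter (fun B : ℤ => (4 * (A : ℤ)) ∣ B ^ 2 + 4 * h) with hT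
  have hsplit : ∑ B ∈ T, kPlus Z (uPair h ((A : ℤ), B) t) =
      ∑ B ∈ T.filter (fun B : ℤ => uPair h ((A : ℤ), B) t ≤ Z), kPlus Z (uPair h ((A : ℤ), B) t) :=
    (sum_filter_of_ne fun B _ hne => by
      by_contra hu
      exact hne (kPlus_eq_zero_of_lt (not_le.mp hu))).symm
  rw [hsplit]
  calc ∑ B ∈ T.filter (fun B : ℤ => uPair h ((A : ℤ), B) t ≤ Z), kPlus Z (uPair h ((A : ℤ), B) t)
      ≤ ∑ B ∈ T.filter (fun B : ℤ => uPair h ((A : ℤ), B) t ≤ Z), (1 : ℝ) :=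
        sum_le_sum fun B _ => kPlus_le_one (uPair_nonneg (show (0 : ℤ) < (A : ℤ) by exact_mod_cast hA) ht)
    _ = #(T.filter (fun B : ℤ => uPair h ((A : ℤ), B) t ≤ Z)) := by simp
    _ ≤ _ := card_row_support_le hh hA ht Z N'

/-- **Row bound, far from the diagonal** (`A > A'`, weight `≤ 2√(AA')/(A − A')`):
`rowSum ≤ (2√(AA')/(A − A')) (4√(hZ/(AA')) + 2) ρ(1,0,h; A)`.
[cite: GrimmeltMerikoski2025, §4.1.2 (contribution of 𝔠₁ > 10𝔠₂)] -/
theorem rowSum_le_of_lt {h : ℕ} (hh : 0 < h) {A : ℕ} {t : ℤ × ℤ} (ht : 0 < t.1) (htA : t.1 < A)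
    (Z : ℝ) (N' : ℕ) :
    rowSum h Z t A N' ≤ (2 * Real.sqrt ((A : ℝ) * t.1) / ((A : ℝ) - t.1)) *
      ((4 * Real.sqrt (h * Z / ((A : ℝ) * t.1)) + 2) * quadRootCount 1 0 h A) := by
  have hA : 0 < A := by
    have : (0 : ℤ) < A := ht.trans htA
    exact_mod_cast this
  unfold rowSum
  set T := (Icc (-(N' : ℤ)) N').filter (fun B : ℤ => (4 * (A : ℤ)) ∣ B ^ 2 + 4 * h) with hT
  set w : ℝ := 2 * Real.sqrt ((A : ℝ) * t.1) / ((A : ℝ) - t.1) with hw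
  have hw0 : 0 ≤ w := by
    have : (t.1 : ℝ) < A := by exact_mod_cast htA
    rw [hw]; exact div_nonneg (by positivity) (by linarith)
  have hsplit : ∑ B ∈ T, kPlus Z (uPair h ((A : ℤ), B) t) =
      ∑ B ∈ T.filter (fun B : ℤ => uPair h ((A : ℤ), B) t ≤ Z), kPlus Z (uPair h ((A : ℤ), B) t) :=
    (sum_filter_of_ne fun B _ hne => by
      by_contra hu
      exact hne (kPlus_eq_zero_of_lt (not_le.mp hu))).symm
  rw [hsplit]
  calc ∑ B ∈ T.filter (fun B : ℤ => uPair h ((A : ℤ), B) t ≤ Z), kPlus Z (uPair h ((A : ℤ), B) t)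
      ≤ ∑ B ∈ T.filter (fun B : ℤ => uPair h ((A : ℤ), B) t ≤ Z), w := by
        refine sum_le_sum fun B _ => ?_
        have := kPlus_uPair_le_of_lt hh (s := ((A : ℤ), B)) htA ht Z
        simpa [hw] using this
    _ = w * #(T.filter (fun B : ℤ => uPair h ((A : ℤ), B) t ≤ Z)) := by rw [sum_const, nsmul_eq_mul, mul_comm]
    _ ≤ w * ((4 * Real.sqrt (h * Z / ((A : ℝ) * t.1)) + 2) * quadRootCount 1 0 h A) :=
        mul_le_mul_of_nonneg_left (card_row_support_le hh hA ht Z N') hw0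

/-- Rows beyond `(2 + 4Z)A'` vanish. [cite: GrimmeltMerikoski2025, §4.1.2 (𝔠₁ ≪ Z𝔠₂)] -/
theorem rowSum_eq_zero_of_lt {h : ℕ} (hh : 0 < h) {A : ℕ} (hA : 0 < A) {t : ℤ × ℤ} (ht : 0 < t.1)
    {Z : ℝ} (hfar : (2 + 4 * Z) * t.1 < A) (N' : ℕ) : rowSum h Z t A N' = 0 := by
  unfold rowSum
  refine sum_eq_zero fun B _ => kPlus_eq_zero_of_lt ?_
  by_contra hu
  have := fst_le_of_uPair_le hh (s := ((A : ℤ), B)) (show (0 : ℤ) < (A : ℤ) by exact_mod_cast hA) ht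
    (not_lt.mp hu)
  simp only [Int.cast_natCast] at this
  linarith

end heegnerCounting

/-! ### Numeric helpers -/

section numerics

/-- `∑_{A=1}^{M} 1/√A ≤ 2√M`. [folklore] -/
theorem sum_Icc_inv_sqrt_le (M : ℕ) :
    ∑ A ∈ Icc 1 M, (Real.sqrt (A : ℝ))⁻¹ ≤ 2 * Real.sqrt (M : ℝ) := by
  induction M with
  | zero => simp
  | succ M ih =>
    rw [sum_Icc_succ_top (by omega : 1 ≤ M + 1), Nat.cast_succ]
    set s := Real.sqrt ((M : ℝ) + 1) with hs
    set r := Real.sqrt (M : ℝ) with hr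
    have hs2 : s ^ 2 = (M : ℝ) + 1 := Real.sq_sqrt (by positivity)
    have hr2 : r ^ 2 = (M : ℝ) := Real.sq_sqrt (by positivity)
    have hr0 : 0 ≤ r := Real.sqrt_nonneg _
    have hs0 : 0 < s := Real.sqrt_pos.mpr (by positivity)
    have hkey : s⁻¹ ≤ 2 * (s - r) := by
      rw [inv_le_iff_one_le_mul₀ hs0]
      nlinarith [sq_nonneg (s - r)]
    linarith

/-- `4^{ω(n)} ≤ τ(n)²` (from `2^{ω(n)} ≤ τ(n)`, cf.
`FriedlanderIwaniecPrimes.two_pow_card_primeFactors_le_card_divisors`, re-proved inline to keep the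
import closure small). [folklore] -/
theorem four_pow_card_primeFactors_le {n : ℕ} (hn : n ≠ 0) :
    (4 : ℝ) ^ n.primeFactors.card ≤ (#n.divisors : ℝ) ^ 2 := by
  have h : 2 ^ n.primeFactors.card ≤ #n.divisors := by
    rw [Nat.card_divisors hn, ← prod_const]
    refine prod_le_prod' fun p hp => ?_
    have : 0 < n.factorization p := Nat.Prime.factorization_pos_of_dvd
      (Nat.prime_of_mem_primeFactors hp) hn (Nat.dvd_of_mem_primeFactors hp)
    omega
  have h' : ((2 ^ n.primeFactors.card : ℕ) : ℝ) ≤ #n.divisors := by exact_mod_cast h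
  calc (4 : ℝ) ^ n.primeFactors.card = ((2 : ℝ) ^ n.primeFactors.card) ^ 2 := by
        rw [← pow_mul, mul_comm, pow_mul]; norm_num
    _ ≤ (#n.divisors : ℝ) ^ 2 := by
        push_cast at h'
        exact pow_le_pow_left₀ (by positivity) h' 2

end numerics

/-! ### The root count `ρ(1, 0, ah₀; A)` for `h₀` square-free, `gcd(a, h₀) = 1` -/

section rhoBound

/-- `p^{2j} ∣ a h₀` forces `p^j ∣ a` (`h₀` square-free, `gcd(a, h₀) = 1`). [folklore] -/
theorem pow_dvd_of_pow_two_mul_dvd {a h₀ : ℕ} (hsq : Squarefree h₀) (hcop : a.Coprime h₀)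
    {p j : ℕ} (hp : p.Prime) (hdvd : (p : ℤ) ^ (2 * j) ∣ ((a * h₀ : ℕ) : ℤ)) : p ^ j ∣ a := by
  rcases Nat.eq_zero_or_pos j with rfl | hj
  · simp
  have hdvd' : p ^ (2 * j) ∣ a * h₀ := by exact_mod_cast hdvd
  by_cases hph : p ∣ h₀
  · exfalso
    have hpa : ¬ p ∣ a := fun h => hp.ne_one (by
      have h1 : p ∣ Nat.gcd a h₀ := Nat.dvd_gcd h hph
      rw [Nat.Coprime.gcd_eq_one hcop] at h1
      exact Nat.dvd_one.mp h1)
    have hcop' : (p ^ (2 * j)).Coprime a :=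
      Nat.Coprime.pow_left _ ((Nat.Prime.coprime_iff_not_dvd hp).mpr hpa)
    have h1 : p ^ (2 * j) ∣ h₀ := hcop'.dvd_of_dvd_mul_left hdvd'
    have h2 : p * p ∣ h₀ := by
      refine (Dvd.intro (p ^ (2 * j - 2)) ?_).trans h1
      rw [← pow_two, ← pow_add]; congr 1; omega
    exact (Nat.squarefree_iff_prime_squarefree.mp hsq p hp) h2
  · have hcop' : (p ^ (2 * j)).Coprime h₀ :=
      Nat.Coprime.pow_left _ ((Nat.Prime.coprime_iff_not_dvd hp).mpr hph)
    have h1 : p ^ (2 * j) ∣ a := hcop'.dvd_of_dvd_mul_right hdvd'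
    exact (pow_dvd_pow p (by omega : j ≤ 2 * j)).trans h1

/-- **`ρ(1, 0, ah₀; A) ≤ 4^{ω(A)} a`** for `h₀` square-free and `gcd(a, h₀) = 1` (`G = 1`, `E = a` in
`quadRootCount_le_of_gcd_of_sq`). [folklore] -/
theorem rho_one_le {a h₀ : ℕ} (ha : 0 < a) (hh₀ : 0 < h₀) (hsq : Squarefree h₀) (hcop : a.Coprime h₀)
    {A : ℕ} (hA : 0 < A) :
    quadRootCount 1 0 ((a * h₀ : ℕ) : ℤ) A ≤ 4 ^ A.primeFactors.card * a := by
  have h := quadRootCount_le_of_gcd_of_sq (α := 1) (β := 0) (γ := ((a * h₀ : ℕ) : ℤ)) (G := 1) (E := a)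
    (by simp; exact ⟨ha.ne', hh₀.ne'⟩) one_ne_zero ha.ne' (by simp)
    (fun p j hp hdvd => pow_dvd_of_pow_two_mul_dvd hsq hcop hp (by simpa using hdvd)) hA
  simpa using h

/-- Real form with the divisor bound: `ρ(1,0,ah₀;A) ≤ C² A^{2η} a` whenever `τ(n) ≤ C n^η`. [folklore] -/
theorem rho_one_le_rpow {a h₀ : ℕ} (ha : 0 < a) (hh₀ : 0 < h₀) (hsq : Squarefree h₀) (hcop : a.Coprime h₀)
    {η C : ℝ} (hC : ∀ n : ℕ, (#n.divisors : ℝ) ≤ C * (n : ℝ) ^ η) {A : ℕ} (hA : 0 < A) :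
    (quadRootCount 1 0 ((a * h₀ : ℕ) : ℤ) A : ℝ) ≤ C ^ 2 * (A : ℝ) ^ (2 * η) * a := by
  have h1 : (quadRootCount 1 0 ((a * h₀ : ℕ) : ℤ) A : ℝ) ≤ (4 : ℝ) ^ A.primeFactors.card * a := by
    exact_mod_cast rho_one_le ha hh₀ hsq hcop hA
  have h2 := four_pow_card_primeFactors_le hA.ne'
  have h3 : (#A.divisors : ℝ) ^ 2 ≤ (C * (A : ℝ) ^ η) ^ 2 := pow_le_pow_left₀ (Nat.cast_nonneg _) (hC A) 2
  have h4 : (C * (A : ℝ) ^ η) ^ 2 = C ^ 2 * (A : ℝ) ^ (2 * η) := by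
    rw [mul_pow, show (2 : ℝ) * η = η * (2 : ℕ) by push_cast; ring,
      Real.rpow_mul_natCast (Nat.cast_nonneg _)]
  have ha0 : (0 : ℝ) ≤ a := Nat.cast_nonneg _
  nlinarith [mul_le_mul_of_nonneg_right (h2.trans (h3.trans h4.le)) ha0]

end rhoBound

/-! ### The sum over all rows for a fixed reduced form -/

section coreSum

/-- **Near the diagonal**: `∑_{A ≤ 10A'} rowSum ≤ C²a(10A')^{2η} (8√(10hZ) + 20A')`. [cite: GrimmeltMerikoski2025, §4.1.2 (𝔠₁ ≤ 10𝔠₂)] -/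
theorem sum_rowSum_near_le {a h₀ : ℕ} (ha : 0 < a) (hh₀ : 0 < h₀) (hsq : Squarefree h₀)
    (hcop : a.Coprime h₀) {η C : ℝ} (hη : 0 ≤ η) (hC : ∀ n : ℕ, (#n.divisors : ℝ) ≤ C * (n : ℝ) ^ η)
    {t : ℤ × ℤ} (ht : 0 < t.1) {Z : ℝ} (hZ : 0 ≤ Z) (N' : ℕ) :
    ∑ A ∈ Icc 1 (10 * t.1.toNat), rowSum (a * h₀) Z t A N' ≤
      C ^ 2 * a * (10 * (t.1 : ℝ)) ^ (2 * η) *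
        (8 * Real.sqrt (10 * ((a * h₀ : ℕ) : ℝ) * Z) + 20 * t.1) := by
  set h : ℕ := a * h₀ with hhdef
  have hh : 0 < h := Nat.mul_pos ha hh₀
  set M : ℕ := 10 * t.1.toNat with hM
  have htM : (t.1 : ℝ) = t.1.toNat := by
    have : (t.1 : ℤ) = t.1.toNat := (Int.toNat_of_nonneg ht.le).symm
    exact_mod_cast this
  have hMr : (M : ℝ) = 10 * t.1 := by rw [hM, htM]; push_cast; ring
  have ht' : (0 : ℝ) < t.1 := by exact_mod_cast ht
  have hM0 : (0 : ℝ) ≤ M := Nat.cast_nonneg _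
  have hC0 : 0 ≤ C := by have := hC 1; simp at this; linarith
  -- termwise
  have hterm : ∀ A ∈ Icc 1 M, rowSum h Z t A N' ≤
      C ^ 2 * a * (M : ℝ) ^ (2 * η) * (4 * Real.sqrt (h * Z / t.1) * (Real.sqrt (A : ℝ))⁻¹ + 2) := by
    intro A hA
    rw [mem_Icc] at hA
    have hA0 : 0 < A := hA.1
    have hA' : (0 : ℝ) < A := by exact_mod_cast hA0
    have h1 := rowSum_le hh hA0 ht Z N' (h := h)
    have h2 := rho_one_le_rpow ha hh₀ hsq hcop hC hA0
    have hAM : (A : ℝ) ^ (2 * η) ≤ (M : ℝ) ^ (2 * η) :=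
      Real.rpow_le_rpow (Nat.cast_nonneg _) (by exact_mod_cast hA.2) (by linarith)
    have hsqrt : Real.sqrt (h * Z / ((A : ℝ) * t.1)) = Real.sqrt (h * Z / t.1) * (Real.sqrt (A : ℝ))⁻¹ := by
      rw [show (h : ℝ) * Z / ((A : ℝ) * t.1) = (h * Z / t.1) / A by field_simp,
        Real.sqrt_div' _ hA'.le, div_eq_mul_inv]
    rw [hsqrt] at h1
    have hfac0 : 0 ≤ 4 * (Real.sqrt (↑h * Z / ↑t.1) * (Real.sqrt ↑A)⁻¹) + 2 := by positivity
    calc rowSum h Z t A N' ≤ (4 * (Real.sqrt (h * Z / t.1) * (Real.sqrt (A : ℝ))⁻¹) + 2) *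
          (quadRootCount 1 0 (h : ℤ) A : ℝ) := h1
      _ ≤ (4 * (Real.sqrt (h * Z / t.1) * (Real.sqrt (A : ℝ))⁻¹) + 2) * (C ^ 2 * (A : ℝ) ^ (2 * η) * a) :=
          mul_le_mul_of_nonneg_left h2 hfac0
      _ ≤ (4 * (Real.sqrt (h * Z / t.1) * (Real.sqrt (A : ℝ))⁻¹) + 2) * (C ^ 2 * (M : ℝ) ^ (2 * η) * a) :=
          mul_le_mul_of_nonneg_left (mul_le_mul_of_nonneg_right
            (mul_le_mul_of_nonneg_left hAM (by positivity)) (Nat.cast_nonneg a)) hfac0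
      _ = _ := by ring
  calc ∑ A ∈ Icc 1 M, rowSum h Z t A N'
      ≤ ∑ A ∈ Icc 1 M, C ^ 2 * a * (M : ℝ) ^ (2 * η) * (4 * Real.sqrt (h * Z / t.1) * (Real.sqrt (A : ℝ))⁻¹ + 2) :=
        sum_le_sum hterm
    _ = C ^ 2 * a * (M : ℝ) ^ (2 * η) * (4 * Real.sqrt (h * Z / t.1) * ∑ A ∈ Icc 1 M, (Real.sqrt (A : ℝ))⁻¹ +
          2 * M) := by
        rw [← mul_sum]
        congr 1
        rw [sum_add_distrib, ← mul_sum, sum_const, Nat.card_Icc, Nat.add_sub_cancel, nsmul_eq_mul]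
        ring
    _ ≤ C ^ 2 * a * (M : ℝ) ^ (2 * η) * (4 * Real.sqrt (h * Z / t.1) * (2 * Real.sqrt M) + 2 * M) := by
        have h0 : 0 ≤ C ^ 2 * a * (M : ℝ) ^ (2 * η) := by positivity
        refine mul_le_mul_of_nonneg_left ?_ h0
        have h1 : 0 ≤ 4 * Real.sqrt (h * Z / t.1) := by positivity
        nlinarith [mul_le_mul_of_nonneg_left (sum_Icc_inv_sqrt_le M) h1]
    _ = C ^ 2 * a * (10 * (t.1 : ℝ)) ^ (2 * η) * (8 * Real.sqrt (10 * (h : ℝ) * Z) + 20 * t.1) := by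
        rw [hMr]
        have : Real.sqrt (h * Z / t.1) * Real.sqrt (10 * t.1) = Real.sqrt (10 * (h : ℝ) * Z) := by
          rw [← Real.sqrt_mul (by positivity)]
          congr 1
          field_simp
        calc C ^ 2 * a * (10 * (t.1 : ℝ)) ^ (2 * η) * (4 * Real.sqrt (h * Z / t.1) * (2 * Real.sqrt (10 * t.1)) + 2 * (10 * t.1))
            = C ^ 2 * a * (10 * (t.1 : ℝ)) ^ (2 * η) * (8 * (Real.sqrt (h * Z / t.1) * Real.sqrt (10 * t.1)) + 20 * t.1) := by ring
          _ = _ := by rw [this]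

end coreSum

section coreSumFar

/-- `√(t/A) √(X/(At)) = √X / A` for `A, t > 0`, `X ≥ 0`. [folklore] -/
theorem sqrt_aux (X : ℝ) {A t : ℝ} (hA : 0 < A) (ht : 0 < t) :
    Real.sqrt (t / A) * Real.sqrt (X / (A * t)) = Real.sqrt X / A := by
  rw [← Real.sqrt_mul (by positivity), show t / A * (X / (A * t)) = X / (A ^ 2) by field_simp,
    Real.sqrt_div' _ (by positivity), Real.sqrt_sq hA.le]

/-- The weight far from the diagonal: for `A > 10A'`, `2√(AA')/(A − A') ≤ 3√(A'/A)`. [folklore] -/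
theorem weight_far_le {A t : ℝ} (ht : 0 < t) (hA : 10 * t < A) :
    2 * Real.sqrt (A * t) / (A - t) ≤ 3 * Real.sqrt (t / A) := by
  have hA0 : 0 < A := by linarith
  have hd : 0 < A - t := by linarith
  rw [div_le_iff₀ hd, Real.sqrt_mul hA0.le, Real.sqrt_div' _ hA0.le]
  have hsA : 0 < Real.sqrt A := Real.sqrt_pos.mpr hA0
  have hst : 0 ≤ Real.sqrt t := Real.sqrt_nonneg _
  rw [show 3 * (Real.sqrt t / Real.sqrt A) * (A - t) = Real.sqrt t * (3 * (A - t) / Real.sqrt A) by ring,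
    show 2 * (Real.sqrt A * Real.sqrt t) = Real.sqrt t * (2 * Real.sqrt A) by ring]
  refine mul_le_mul_of_nonneg_left ?_ hst
  rw [le_div_iff₀ hsA, mul_assoc, Real.mul_self_sqrt hA0.le]
  linarith

/-- **Far from the diagonal**: with `M₂ = ⌊(2 + 4Z)A'⌋`,
`∑_{10A' < A ≤ N} rowSum ≤ C²a M₂^{2η} (12√(hZ)(1 + log(M₂ + 1)) + 12√A' √M₂)`.
[cite: GrimmeltMerikoski2025, §4.1.2 (𝔠₁ > 10𝔠₂)] -/
theorem sum_rowSum_far_le {a h₀ : ℕ} (ha : 0 < a) (hh₀ : 0 < h₀) (hsq : Squarefree h₀)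
    (hcop : a.Coprime h₀) {η C : ℝ} (hη : 0 ≤ η) (hC : ∀ n : ℕ, (#n.divisors : ℝ) ≤ C * (n : ℝ) ^ η)
    {t : ℤ × ℤ} (ht : 0 < t.1) {Z : ℝ} (hZ : 0 ≤ Z) (N N' : ℕ) :
    ∑ A ∈ (Icc 1 N).filter (fun A : ℕ => 10 * t.1.toNat < A), rowSum (a * h₀) Z t A N' ≤
      C ^ 2 * a * ((⌊(2 + 4 * Z) * t.1⌋₊ : ℕ) : ℝ) ^ (2 * η) *
        (12 * Real.sqrt (((a * h₀ : ℕ) : ℝ) * Z) * (1 + Real.log (⌊(2 + 4 * Z) * t.1⌋₊ + 1)) +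
          12 * Real.sqrt (t.1 : ℝ) * Real.sqrt (⌊(2 + 4 * Z) * t.1⌋₊ : ℝ)) := by
  set h : ℕ := a * h₀ with hhdef
  have hh : 0 < h := Nat.mul_pos ha hh₀
  set M₂ : ℕ := ⌊(2 + 4 * Z) * t.1⌋₊ with hM₂
  have ht' : (0 : ℝ) < t.1 := by exact_mod_cast ht
  have htM : ((t.1.toNat : ℕ) : ℝ) = t.1 := by
    have : (t.1.toNat : ℤ) = t.1 := Int.toNat_of_nonneg ht.le
    exact_mod_cast this
  have hC0 : 0 ≤ C := by have := hC 1; simp at this; linarith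
  have hM₂le : (M₂ : ℝ) ≤ (2 + 4 * Z) * t.1 := Nat.floor_le (by positivity)
  -- restrict to `A ≤ M₂` (other rows vanish) and drop the lower constraint into the weights
  have hvan : ∀ A ∈ (Icc 1 N).filter (fun A : ℕ => 10 * t.1.toNat < A), M₂ < A → rowSum h Z t A N' = 0 := by
    intro A hA hAM
    rw [mem_filter, mem_Icc] at hA
    refine rowSum_eq_zero_of_lt hh (by omega) ht ?_ N'
    have : (M₂ : ℝ) + 1 ≤ A := by exact_mod_cast hAM
    linarith [Nat.lt_floor_add_one ((2 + 4 * Z) * t.1)]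
  have hstep1 : ∑ A ∈ (Icc 1 N).filter (fun A : ℕ => 10 * t.1.toNat < A), rowSum h Z t A N' =
      ∑ A ∈ ((Icc 1 N).filter (fun A : ℕ => 10 * t.1.toNat < A)).filter (fun A => A ≤ M₂),
        rowSum h Z t A N' := by
    refine (sum_filter_of_ne fun A hA hne => ?_).symm
    by_contra hAM
    exact hne (hvan A hA (not_le.mp hAM))
  have hsub : ((Icc 1 N).filter (fun A : ℕ => 10 * t.1.toNat < A)).filter (fun A => A ≤ M₂) ⊆
      (Icc 1 M₂).filter (fun A : ℕ => 10 * t.1.toNat < A) := by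
    intro A hA
    rw [mem_filter, mem_filter, mem_Icc] at hA
    rw [mem_filter, mem_Icc]
    exact ⟨⟨hA.1.1.1, hA.2⟩, hA.1.2⟩
  -- termwise bound on `Icc 1 M₂` with `A > 10 A'`
  have hterm : ∀ A ∈ (Icc 1 M₂).filter (fun A : ℕ => 10 * t.1.toNat < A), rowSum h Z t A N' ≤
      C ^ 2 * a * (M₂ : ℝ) ^ (2 * η) *
        (12 * Real.sqrt (h * Z) * ((A : ℝ))⁻¹ + 6 * Real.sqrt (t.1 : ℝ) * (Real.sqrt (A : ℝ))⁻¹) := by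
    intro A hA
    rw [mem_filter, mem_Icc] at hA
    have hA0 : 0 < A := hA.1.1
    have hA' : (0 : ℝ) < A := by exact_mod_cast hA0
    have h10 : 10 * (t.1 : ℝ) < A := by
      have : ((10 * t.1.toNat : ℕ) : ℝ) < A := by exact_mod_cast hA.2
      push_cast at this; rw [htM] at this; exact this
    have htA : t.1 < (A : ℤ) := by
      have : (t.1 : ℝ) < A := by linarith
      exact_mod_cast this
    have h1 := rowSum_le_of_lt hh ht htA Z N' (h := h)
    have h2 := rho_one_le_rpow ha hh₀ hsq hcop hC hA0
    have hAM : (A : ℝ) ^ (2 * η) ≤ (M₂ : ℝ) ^ (2 * η) :=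
      Real.rpow_le_rpow (Nat.cast_nonneg _) (by exact_mod_cast hA.1.2) (by linarith)
    have hw := weight_far_le ht' h10
    have hfac0 : 0 ≤ 4 * Real.sqrt (h * Z / ((A : ℝ) * t.1)) + 2 := by positivity
    have hw0 : 0 ≤ 2 * Real.sqrt ((A : ℝ) * t.1) / ((A : ℝ) - t.1) :=
      div_nonneg (by positivity) (by linarith)
    calc rowSum h Z t A N'
        ≤ (2 * Real.sqrt ((A : ℝ) * t.1) / ((A : ℝ) - t.1)) *
            ((4 * Real.sqrt (h * Z / ((A : ℝ) * t.1)) + 2) * (quadRootCount 1 0 (h : ℤ) A : ℝ)) := h1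
      _ ≤ (3 * Real.sqrt ((t.1 : ℝ) / A)) *
            ((4 * Real.sqrt (h * Z / ((A : ℝ) * t.1)) + 2) * (C ^ 2 * (M₂ : ℝ) ^ (2 * η) * a)) := by
          refine mul_le_mul hw (mul_le_mul_of_nonneg_left (h2.trans ?_) hfac0) (by positivity) (by positivity)
          exact mul_le_mul_of_nonneg_right (mul_le_mul_of_nonneg_left hAM (by positivity)) (Nat.cast_nonneg a)
      _ = C ^ 2 * a * (M₂ : ℝ) ^ (2 * η) *
            (12 * (Real.sqrt ((t.1 : ℝ) / A) * Real.sqrt (h * Z / ((A : ℝ) * t.1))) +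
              6 * Real.sqrt ((t.1 : ℝ) / A)) := by ring
      _ = C ^ 2 * a * (M₂ : ℝ) ^ (2 * η) *
            (12 * Real.sqrt (h * Z) * ((A : ℝ))⁻¹ + 6 * Real.sqrt (t.1 : ℝ) * (Real.sqrt (A : ℝ))⁻¹) := by
          rw [sqrt_aux _ hA' ht', Real.sqrt_div' _ hA'.le]
          ring
  calc ∑ A ∈ (Icc 1 N).filter (fun A : ℕ => 10 * t.1.toNat < A), rowSum h Z t A N'
      = ∑ A ∈ ((Icc 1 N).filter (fun A : ℕ => 10 * t.1.toNat < A)).filter (fun A => A ≤ M₂),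
          rowSum h Z t A N' := hstep1
    _ ≤ ∑ A ∈ (Icc 1 M₂).filter (fun A : ℕ => 10 * t.1.toNat < A), rowSum h Z t A N' :=
        sum_le_sum_of_subset_of_nonneg hsub fun A _ _ => rowSum_nonneg _ _ _ _ _
    _ ≤ ∑ A ∈ (Icc 1 M₂).filter (fun A : ℕ => 10 * t.1.toNat < A), C ^ 2 * a * (M₂ : ℝ) ^ (2 * η) *
          (12 * Real.sqrt (h * Z) * ((A : ℝ))⁻¹ + 6 * Real.sqrt (t.1 : ℝ) * (Real.sqrt (A : ℝ))⁻¹) :=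
        sum_le_sum hterm
    _ ≤ ∑ A ∈ Icc 1 M₂, C ^ 2 * a * (M₂ : ℝ) ^ (2 * η) *
          (12 * Real.sqrt (h * Z) * ((A : ℝ))⁻¹ + 6 * Real.sqrt (t.1 : ℝ) * (Real.sqrt (A : ℝ))⁻¹) :=
        sum_le_sum_of_subset_of_nonneg (filter_subset _ _) fun A _ _ => by positivity
    _ = C ^ 2 * a * (M₂ : ℝ) ^ (2 * η) * (12 * Real.sqrt (h * Z) * ∑ A ∈ Icc 1 M₂, ((A : ℝ))⁻¹ +
          6 * Real.sqrt (t.1 : ℝ) * ∑ A ∈ Icc 1 M₂, (Real.sqrt (A : ℝ))⁻¹) := by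
        rw [← mul_sum, sum_add_distrib, ← mul_sum, ← mul_sum]
    _ ≤ C ^ 2 * a * (M₂ : ℝ) ^ (2 * η) * (12 * Real.sqrt (h * Z) * (1 + Real.log (M₂ + 1)) +
          6 * Real.sqrt (t.1 : ℝ) * (2 * Real.sqrt (M₂ : ℝ))) := by
        have h0 : 0 ≤ C ^ 2 * a * (M₂ : ℝ) ^ (2 * η) := by positivity
        refine mul_le_mul_of_nonneg_left (add_le_add ?_ ?_) h0
        · exact mul_le_mul_of_nonneg_left (sum_Icc_inv_le_log M₂) (by positivity)
        · exact mul_le_mul_of_nonneg_left (sum_Icc_inv_sqrt_le M₂) (by positivity)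
    _ = _ := by ring

end coreSumFar

/-! ### The forms of discriminant `−4h`: all pairs, the reduced (Heegner) representatives, the resultant -/

section formsData

/-- The forms `[A, B, (B² + 4h)/(4A)]` of discriminant `−4h` with `0 < A ≤ N`, `|B| ≤ N'`, as pairs
`(A, B)` with `4A ∣ B² + 4h` — the points `w₁ ∈ 𝒮_h` of [GrimmeltMerikoski2025, §4.1] in a box.
[cite: GrimmeltMerikoski2025, §3.1 (S_h) and §4.1 (w₁ ∈ 𝒮_h)] -/
def discPairs (h : ℕ) (N N' : ℕ) : Finset (ℕ × ℤ) :=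
  ((Icc 1 N) ×ˢ (Icc (-(N' : ℤ)) N')).filter (fun s => (4 * (s.1 : ℤ)) ∣ s.2 ^ 2 + 4 * h)

/-- The last coefficient `C = (B² + 4h)/(4A)`. [folklore] -/
def formC (h : ℕ) (s : ℤ × ℤ) : ℤ := (s.2 ^ 2 + 4 * h) / (4 * s.1)

/-- **The reduced representatives** (Heegner points in the standard fundamental domain,
[GrimmeltMerikoski2025, (3.2) Λ_h]): pairs `(A, B)` with `4A ∣ B² + 4h`, `|B| ≤ A ≤ C`, i.e.
`|Re z| ≤ 1/2`, `|z| ≥ 1` for `z = (−B + i√(4h))/(2A)`; every positive definite form of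
discriminant `−4h` is `SL₂(ℤ)`-equivalent to one of them (Lagrange reduction,
`RootForms.exists_smul_isLagrangeReduced`).  As a finite set (box `A ≤ 2h`, `|B| ≤ 2h`).
[cite: GrimmeltMerikoski2025, §3.1 (Λ_h and (3.2): 𝔠 ≤ 2√h, |𝔟| ≤ 𝔠/2)] -/
def heegnerReps (h : ℕ) : Finset (ℤ × ℤ) :=
  ((Icc (1 : ℤ) (2 * h)) ×ˢ (Icc (-(2 * h : ℤ)) (2 * h))).filter
    (fun t => (4 * t.1) ∣ t.2 ^ 2 + 4 * h ∧ |t.2| ≤ t.1 ∧ 4 * t.1 ^ 2 ≤ t.2 ^ 2 + 4 * h)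

/-- Members of `discPairs`. [folklore] -/
theorem mem_discPairs {h N N' : ℕ} {s : ℕ × ℤ} :
    s ∈ discPairs h N N' ↔ (1 ≤ s.1 ∧ s.1 ≤ N) ∧ (-(N' : ℤ) ≤ s.2 ∧ s.2 ≤ N') ∧
      (4 * (s.1 : ℤ)) ∣ s.2 ^ 2 + 4 * h := by
  simp only [discPairs, mem_filter, mem_product, mem_Icc, and_assoc]

/-- The sum over `discPairs` is the sum of the rows. [folklore] -/
theorem sum_discPairs_eq_sum_rowSum (h : ℕ) (Z : ℝ) (t : ℤ × ℤ) (N N' : ℕ) :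
    ∑ s ∈ discPairs h N N', kPlus Z (uPair h ((s.1 : ℤ), s.2) t) = ∑ A ∈ Icc 1 N, rowSum h Z t A N' := by
  unfold discPairs rowSum
  rw [sum_filter, sum_product]
  refine sum_congr rfl fun A _ => ?_
  rw [sum_filter]

/-- Members of `heegnerReps`: `A ≥ 1`, `4A ∣ B² + 4h`, `|B| ≤ A`, `4A² ≤ B² + 4h`, hence
`3A² ≤ 4h`. [cite: GrimmeltMerikoski2025, (3.2)] -/
theorem mem_heegnerReps {h : ℕ} {t : ℤ × ℤ} (ht : t ∈ heegnerReps h) :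
    1 ≤ t.1 ∧ (4 * t.1) ∣ t.2 ^ 2 + 4 * h ∧ |t.2| ≤ t.1 ∧ 4 * t.1 ^ 2 ≤ t.2 ^ 2 + 4 * h ∧ 3 * t.1 ^ 2 ≤ 4 * h := by
  simp only [heegnerReps, mem_filter, mem_product, mem_Icc] at ht
  obtain ⟨⟨⟨h1, _⟩, _⟩, hdvd, hB, hAC⟩ := ht
  refine ⟨h1, hdvd, hB, hAC, ?_⟩
  have : t.2 ^ 2 ≤ t.1 ^ 2 := by
    have := abs_le.mp hB
    nlinarith
  linarith

/-- A reduced form has `A ≤ 2√h` (indeed `A ≤ 2√(h/3)`). [cite: GrimmeltMerikoski2025, (3.2) (𝔠 ≤ 2√h)] -/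
theorem fst_le_two_sqrt_of_mem_heegnerReps {h : ℕ} {t : ℤ × ℤ} (ht : t ∈ heegnerReps h) :
    (t.1 : ℝ) ≤ 2 * Real.sqrt h := by
  obtain ⟨h1, -, -, -, h3⟩ := mem_heegnerReps ht
  have h3' : 3 * (t.1 : ℝ) ^ 2 ≤ 4 * h := by exact_mod_cast h3
  have h1' : (0 : ℝ) ≤ t.1 := by exact_mod_cast (zero_le_one.trans h1)
  have hs := Real.sq_sqrt (Nat.cast_nonneg h : (0 : ℝ) ≤ h)
  nlinarith [Real.sqrt_nonneg (h : ℝ)]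

/-- **The number of reduced forms**: `#Λ_h ≤ ∑_{A ≤ 2√h} 3ρ(1,0,h;A) ≤ 3C²a (2√h)^{1+2η} + …`,
here in the form `#Λ_{ah₀} ≤ 3 C² a (2√(ah₀) + 1)^{1 + 2η}`.
[cite: GrimmeltMerikoski2025, §3.1 ("#Λ_h ≤ h^{1/2+o(1)}")] -/
theorem card_heegnerReps_le {a h₀ : ℕ} (ha : 0 < a) (hh₀ : 0 < h₀) (hsq : Squarefree h₀)
    (hcop : a.Coprime h₀) {η C : ℝ} (hη : 0 ≤ η) (hC : ∀ n : ℕ, (#n.divisors : ℝ) ≤ C * (n : ℝ) ^ η) :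
    (#(heegnerReps (a * h₀)) : ℝ) ≤ 3 * C ^ 2 * a * (2 * Real.sqrt ((a * h₀ : ℕ) : ℝ) + 1) ^ (1 + 2 * η) := by
  set h : ℕ := a * h₀ with hhdef
  have hh : 0 < h := Nat.mul_pos ha hh₀
  set M : ℕ := ⌊2 * Real.sqrt (h : ℝ)⌋₊ with hM
  have hC0 : 0 ≤ C := by have := hC 1; simp at this; linarith
  -- `Λ ⊆ ⋃_{A ≤ M} {A} × {B ∈ [-A, A] : 4A ∣ B² + 4h}`; inject each slice by `B ↦ B/2`
  have hsub : heegnerReps h ⊆ (Icc (1 : ℤ) M).biUnion (fun A =>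
      ((Icc (-A) A).filter (fun B : ℤ => (4 * A) ∣ B ^ 2 + 4 * h)).image (fun B => (A, B))) := by
    intro t ht
    have hA2 := fst_le_two_sqrt_of_mem_heegnerReps ht
    obtain ⟨h1, hdvd, hB, -, -⟩ := mem_heegnerReps ht
    rw [mem_biUnion]
    refine ⟨t.1, mem_Icc.mpr ⟨h1, ?_⟩, mem_image.mpr ⟨t.2, mem_filter.mpr ⟨mem_Icc.mpr (abs_le.mp hB), hdvd⟩, rfl⟩⟩
    have : (t.1 : ℝ) ≤ M := by
      rw [hM]
      have h0 : (0 : ℝ) ≤ 2 * Real.sqrt h := by positivity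
      have := Nat.floor_le h0  -- ⌊x⌋₊ ≤ x ; we need t.1 ≤ ⌊x⌋₊ from t.1 ≤ x, t.1 integer
      have ht1 : (t.1 : ℝ) = ((t.1.toNat : ℕ) : ℝ) := by
        have : (t.1 : ℤ) = t.1.toNat := (Int.toNat_of_nonneg (zero_le_one.trans h1)).symm
        exact_mod_cast this
      rw [ht1] at hA2 ⊢
      exact_mod_cast Nat.le_floor hA2
    exact_mod_cast this
  have hslice : ∀ A ∈ Icc (1 : ℤ) M,
      (#(((Icc (-A) A).filter (fun B : ℤ => (4 * A) ∣ B ^ 2 + 4 * h)).image (fun B => (A, B))) : ℝ) ≤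
        3 * (C ^ 2 * (M : ℝ) ^ (2 * η) * a) := by
    intro A hA
    rw [mem_Icc] at hA
    have hA0 : 0 < A := hA.1
    set An : ℕ := A.toNat with hAn
    have hAAn : (A : ℤ) = An := (Int.toNat_of_nonneg hA0.le).symm
    have hAn0 : 0 < An := by omega
    rw [card_image_of_injective _ (fun B B' hBB' => by simpa using hBB')]
    -- inject into the window roots `b ∈ [-A, -A + 2A]`, `A ∣ b² + h`
    set S := (Icc (-A) A).filter (fun B : ℤ => (4 * A) ∣ B ^ 2 + 4 * h) with hS
    have heven : ∀ B ∈ S, (2 : ℤ) ∣ B := by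
      intro B hB
      rw [hS, mem_filter] at hB
      have h4 : (4 : ℤ) ∣ B ^ 2 + 4 * h := (dvd_mul_right 4 A).trans hB.2
      have h4' : (4 : ℤ) ∣ B ^ 2 := by
        have := dvd_sub h4 (dvd_mul_right 4 (h : ℤ)); rwa [add_sub_cancel_right] at this
      exact Int.prime_two.dvd_of_dvd_pow ((show (2:ℤ) ∣ 4 by norm_num).trans h4')
    have hmaps : ∀ B ∈ S, B / 2 ∈ (Icc (-A) (-A + (2 * An : ℕ))).filter (fun b : ℤ => (An : ℤ) ∣ b ^ 2 + h) := by
      intro B hB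
      obtain ⟨b, rfl⟩ := heven B hB
      rw [hS, mem_filter, mem_Icc] at hB
      have hb2 : 2 * b / 2 = b := by omega
      rw [hb2, mem_filter, mem_Icc, ← hAAn]
      refine ⟨⟨by omega, by push_cast; omega⟩, ?_⟩
      have : (4 * A) ∣ 4 * (b ^ 2 + h) := by
        rw [show (4 : ℤ) * (b ^ 2 + h) = (2 * b) ^ 2 + 4 * h by ring]; exact hB.2
      exact Int.dvd_of_mul_dvd_mul_left (by norm_num) this
    have hinj : Set.InjOn (fun B : ℤ => B / 2) ↑S := by
      intro B hB B' hB' hBB'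
      obtain ⟨b, rfl⟩ := heven B hB
      obtain ⟨b', rfl⟩ := heven B' hB'
      simp only at hBB'
      omega
    have h1 := card_le_card_of_injOn _ hmaps hinj
    have h2 := card_window_sq_le (h : ℤ) hAn0 (-A) (2 * An)
    have h3 := rho_one_le_rpow ha hh₀ hsq hcop hC hAn0
    have hAM : ((An : ℕ) : ℝ) ^ (2 * η) ≤ (M : ℝ) ^ (2 * η) := by
      refine Real.rpow_le_rpow (Nat.cast_nonneg _) ?_ (by linarith)
      have : (An : ℤ) ≤ M := by rw [← hAAn]; exact hA.2
      exact_mod_cast this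
    have hdiv : 2 * An / An + 1 = 3 := by rw [Nat.mul_div_cancel _ hAn0]
    calc (#S : ℝ) ≤ #((Icc (-A) (-A + (2 * An : ℕ))).filter (fun b : ℤ => (An : ℤ) ∣ b ^ 2 + h)) := by
          exact_mod_cast h1
      _ ≤ ((2 * An / An + 1 : ℕ) : ℝ) * quadRootCount 1 0 (h : ℤ) An := by exact_mod_cast h2
      _ = 3 * (quadRootCount 1 0 (h : ℤ) An : ℝ) := by rw [hdiv]; norm_num
      _ ≤ 3 * (C ^ 2 * (An : ℝ) ^ (2 * η) * a) := by linarith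
      _ ≤ 3 * (C ^ 2 * (M : ℝ) ^ (2 * η) * a) := by gcongr
  calc (#(heegnerReps h) : ℝ)
      ≤ #((Icc (1 : ℤ) M).biUnion (fun A =>
          ((Icc (-A) A).filter (fun B : ℤ => (4 * A) ∣ B ^ 2 + 4 * h)).image (fun B => (A, B)))) := by
        exact_mod_cast card_le_card hsub
    _ ≤ ∑ A ∈ Icc (1 : ℤ) M, (#(((Icc (-A) A).filter (fun B : ℤ => (4 * A) ∣ B ^ 2 + 4 * h)).image
          (fun B => (A, B))) : ℝ) := by exact_mod_cast card_biUnion_le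
    _ ≤ ∑ A ∈ Icc (1 : ℤ) M, 3 * (C ^ 2 * (M : ℝ) ^ (2 * η) * a) := sum_le_sum hslice
    _ = M * (3 * (C ^ 2 * (M : ℝ) ^ (2 * η) * a)) := by
        rw [sum_const, nsmul_eq_mul, Int.card_Icc]
        congr 1
        rw [show (M : ℤ) + 1 - 1 = (M : ℕ) by ring, Int.toNat_natCast]
    _ ≤ (2 * Real.sqrt h + 1) * (3 * (C ^ 2 * (2 * Real.sqrt h + 1) ^ (2 * η) * a)) := by
        have hMle : (M : ℝ) ≤ 2 * Real.sqrt h := Nat.floor_le (by positivity)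
        have hMle' : (M : ℝ) ≤ 2 * Real.sqrt h + 1 := by linarith
        have hpow : (M : ℝ) ^ (2 * η) ≤ (2 * Real.sqrt h + 1) ^ (2 * η) :=
          Real.rpow_le_rpow (Nat.cast_nonneg _) hMle' (by linarith)
        have h0 : 0 ≤ 3 * (C ^ 2 * (M : ℝ) ^ (2 * η) * a) := by positivity
        calc (M : ℝ) * (3 * (C ^ 2 * (M : ℝ) ^ (2 * η) * a))
            ≤ (2 * Real.sqrt h + 1) * (3 * (C ^ 2 * (M : ℝ) ^ (2 * η) * a)) := mul_le_mul_of_nonneg_right hMle' h0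
          _ ≤ (2 * Real.sqrt h + 1) * (3 * (C ^ 2 * (2 * Real.sqrt h + 1) ^ (2 * η) * a)) := by
              gcongr
    _ = 3 * C ^ 2 * a * (2 * Real.sqrt h + 1) ^ (1 + 2 * η) := by
        rw [Real.rpow_add (by positivity), Real.rpow_one]; ring

end formsData


section resultant

/-- `4A · C = B² + 4h` for the last coefficient `C = formC`. [folklore] -/
theorem formC_spec {h : ℕ} {s : ℤ × ℤ} (hs : (4 * s.1) ∣ s.2 ^ 2 + 4 * h) :
    4 * s.1 * formC h s = s.2 ^ 2 + 4 * h := by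
  unfold formC; exact Int.mul_ediv_cancel' hs

/-- **The resultant** of the forms `[A, B, C]`, `[A', B', C']`:
`Res = (AC' − A'C)² − (AB' − A'B)(BC' − B'C)`.  Two forms with a common zero modulo `q` at a
point of `P¹(ℤ/q)` have `q ∣ Res` (assembly layer); here we need its size and non-vanishing.
[cite: GrimmeltMerikoski2025, §4.1.2 (the form F(w₁, z₂) with F ≡ 0 (mod q), F ≠ 0 for w₁ ≠ z₂)] -/
def resPair (h : ℕ) (s t : ℤ × ℤ) : ℤ :=
  (s.1 * formC h t - t.1 * formC h s) ^ 2 - (s.1 * t.2 - t.1 * s.2) * (s.2 * formC h t - t.2 * formC h s)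

/-- The numerator `N = (BA' − B'A)² + 4h(A' − A)²` of `u = N/(16hAA')`. [folklore] -/
def nPair (h : ℕ) (s t : ℤ × ℤ) : ℤ := (s.2 * t.1 - t.2 * s.1) ^ 2 + 4 * h * (t.1 - s.1) ^ 2

/-- `u = N/(16hAA')`. [folklore] -/
theorem uPair_eq (h : ℕ) (s t : ℤ × ℤ) : uPair h s t = (nPair h s t : ℝ) / (16 * (h : ℝ) * s.1 * t.1) := by
  unfold uPair nPair; push_cast; ring_nf

/-- **The resultant in terms of the point-pair invariant**: for two forms of discriminant `−4h`,
`16A²A'² · Res = N(N + 16hAA')`, i.e. `Res = 16h² u(u + 1)` (the roots are `z, z̄` and `w, w̄`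
with `|z − w|² = 4 Im z Im w · u`, `|z − w̄|² = 4 Im z Im w · (u + 1)`). [folklore] -/
theorem res_identity {h : ℕ} {s t : ℤ × ℤ} (hs0 : s.1 ≠ 0) (ht0 : t.1 ≠ 0)
    (hs : (4 * s.1) ∣ s.2 ^ 2 + 4 * h) (ht : (4 * t.1) ∣ t.2 ^ 2 + 4 * h) :
    16 * s.1 ^ 2 * t.1 ^ 2 * resPair h s t = nPair h s t * (nPair h s t + 16 * h * s.1 * t.1) := by
  have e1 := formC_spec hs
  have e2 := formC_spec ht
  have hsR : (s.1 : ℝ) ≠ 0 := by exact_mod_cast hs0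
  have htR : (t.1 : ℝ) ≠ 0 := by exact_mod_cast ht0
  have hCs : (formC h s : ℝ) = ((s.2 : ℝ) ^ 2 + 4 * h) / (4 * s.1) := by
    rw [eq_div_iff (by positivity)]
    have := congrArg (fun z : ℤ => (z : ℝ)) e1
    push_cast at this
    linarith
  have hCt : (formC h t : ℝ) = ((t.2 : ℝ) ^ 2 + 4 * h) / (4 * t.1) := by
    rw [eq_div_iff (by positivity)]
    have := congrArg (fun z : ℤ => (z : ℝ)) e2
    push_cast at this
    linarith
  have key : ((16 * s.1 ^ 2 * t.1 ^ 2 * resPair h s t : ℤ) : ℝ) =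
      ((nPair h s t * (nPair h s t + 16 * h * s.1 * t.1) : ℤ) : ℝ) := by
    unfold resPair nPair
    push_cast
    rw [hCs, hCt]
    field_simp
    ring
  exact_mod_cast key

/-- `N = 0` only on the diagonal. [folklore] -/
theorem nPair_pos {h : ℕ} (hh : 0 < h) {s t : ℤ × ℤ} (hs : 0 < s.1) (hst : s ≠ t) : 0 < nPair h s t := by
  unfold nPair
  have h1 := sq_nonneg (s.2 * t.1 - t.2 * s.1)
  have h2 : 0 ≤ 4 * (h : ℤ) * (t.1 - s.1) ^ 2 := by positivity
  rcases (add_nonneg h1 h2).lt_or_eq with hlt | heq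
  · exact hlt
  · exfalso
    have hY : (t.1 - s.1) ^ 2 = 0 := by nlinarith
    have hY' : t.1 = s.1 := by nlinarith [sq_nonneg (t.1 - s.1), pow_eq_zero_iff (n := 2) (a := t.1 - s.1) two_ne_zero |>.mp hY]
    have hX : (s.2 * t.1 - t.2 * s.1) ^ 2 = 0 := by nlinarith
    have hX' : s.2 * t.1 - t.2 * s.1 = 0 := pow_eq_zero_iff two_ne_zero |>.mp hX
    rw [hY'] at hX'
    have : s.2 = t.2 := by
      have : s.1 * (s.2 - t.2) = 0 := by linarith
      rcases mul_eq_zero.mp this with h0 | h0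
      · omega
      · linarith
    exact hst (Prod.ext hY'.symm this)

/-- **Off the diagonal the resultant is a positive integer.** [cite: GrimmeltMerikoski2025, §4.1.2 ("for w₁ ≠ z₂ we have F(w₁,z₂) ≠ 0")] -/
theorem resPair_pos {h : ℕ} (hh : 0 < h) {s t : ℤ × ℤ} (hs : 0 < s.1) (ht : 0 < t.1)
    (hs4 : (4 * s.1) ∣ s.2 ^ 2 + 4 * h) (ht4 : (4 * t.1) ∣ t.2 ^ 2 + 4 * h) (hst : s ≠ t) :
    0 < resPair h s t := by
  have hid := res_identity hs.ne' ht.ne' hs4 ht4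
  have hN := nPair_pos hh hs hst
  have hrhs : 0 < nPair h s t * (nPair h s t + 16 * h * s.1 * t.1) := by positivity
  rw [← hid] at hrhs
  have h16 : 0 < 16 * s.1 ^ 2 * t.1 ^ 2 := by positivity
  exact pos_of_mul_pos_right hrhs h16.le

/-- **Size of the resultant on the support**: `u ≤ Z` gives `N ≤ 16hZAA'` and
`Res = N(N + 16hAA')/(16A²A'²) ≤ 16h²Z(Z + 1)`. [cite: GrimmeltMerikoski2025, §4.1.2] -/
theorem resPair_le {h : ℕ} (hh : 0 < h) {s t : ℤ × ℤ} (hs : 0 < s.1) (ht : 0 < t.1)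
    (hs4 : (4 * s.1) ∣ s.2 ^ 2 + 4 * h) (ht4 : (4 * t.1) ∣ t.2 ^ 2 + 4 * h) {Z : ℝ} (hZ : 0 ≤ Z)
    (hu : uPair h s t ≤ Z) : (resPair h s t : ℝ) ≤ 16 * (h : ℝ) ^ 2 * Z * (Z + 1) := by
  have hid := res_identity hs.ne' ht.ne' hs4 ht4
  have hidR : (16 : ℝ) * (s.1 : ℝ) ^ 2 * (t.1 : ℝ) ^ 2 * resPair h s t =
      (nPair h s t : ℝ) * (nPair h s t + 16 * h * s.1 * t.1) := by exact_mod_cast hid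
  have hs' : (0 : ℝ) < s.1 := by exact_mod_cast hs
  have ht' : (0 : ℝ) < t.1 := by exact_mod_cast ht
  have hh' : (0 : ℝ) < h := by exact_mod_cast hh
  have hN0 : (0 : ℝ) ≤ nPair h s t := by
    have : (0 : ℤ) ≤ nPair h s t := by unfold nPair; positivity
    exact_mod_cast this
  have hNle : (nPair h s t : ℝ) ≤ 16 * h * Z * s.1 * t.1 := by
    rw [uPair_eq, div_le_iff₀ (by positivity)] at hu
    linarith
  have h16 : (0 : ℝ) < 16 * (s.1 : ℝ) ^ 2 * (t.1 : ℝ) ^ 2 := by positivity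
  refine le_of_mul_le_mul_left ?_ h16
  rw [hidR]
  calc (nPair h s t : ℝ) * (nPair h s t + 16 * h * s.1 * t.1)
      ≤ (16 * h * Z * s.1 * t.1) * (16 * h * Z * s.1 * t.1 + 16 * h * s.1 * t.1) :=
        mul_le_mul hNle (by linarith) (by positivity) (by positivity)
    _ = 16 * (s.1 : ℝ) ^ 2 * (t.1 : ℝ) ^ 2 * (16 * (h : ℝ) ^ 2 * Z * (Z + 1)) := by ring

end resultant

section levelMult

/-- `g² ∣ a h₀` forces `g ∣ a` (`h₀` square-free, `gcd(a, h₀) = 1`). [folklore] -/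
theorem dvd_of_sq_dvd_mul {g a h₀ : ℕ} (hsq : Squarefree h₀) (hcop : a.Coprime h₀)
    (hg : g ^ 2 ∣ a * h₀) : g ∣ a := by
  have hu1 : Nat.gcd g h₀ ∣ g := Nat.gcd_dvd_left _ _
  have hu2 : Nat.gcd g h₀ ∣ h₀ := Nat.gcd_dvd_right _ _
  have hua : (Nat.gcd g h₀).Coprime a := Nat.Coprime.coprime_dvd_left hu2 hcop.symm
  have hu2' : Nat.gcd g h₀ ^ 2 ∣ h₀ := by
    have h1 : Nat.gcd g h₀ ^ 2 ∣ a * h₀ := (pow_dvd_pow_of_dvd hu1 2).trans hg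
    exact (hua.pow_left 2).dvd_of_dvd_mul_left h1
  have hu_one : Nat.gcd g h₀ = 1 := by
    have := hsq (Nat.gcd g h₀) (by rw [← pow_two]; exact hu2')
    exact Nat.isUnit_iff.mp this
  have hcop' : (g ^ 2).Coprime h₀ := Nat.Coprime.pow_left 2 hu_one
  exact (dvd_pow_self g two_ne_zero).trans (hcop'.dvd_of_dvd_mul_right hg)

/-- **The level-multiplicity bound** `∑_{e ∣ gcd(A, q)} ρ(A/e, B, Ce; q/e)` for the form
`[A, B, C]` of `t` — by `card_levelCosets_le_sum` an upper bound for the number of cosets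
`τ ∈ Γ₀(q)∖SL₂(ℤ)` with `𝔠(τ z_t) ≡ 0 (mod q)` (assembly layer).
[cite: GrimmeltMerikoski2025, §4.1 (∑_τ α_q(τ z₂))] -/
def levelMultBound (h q : ℕ) (t : ℤ × ℤ) : ℕ :=
  ∑ e ∈ (Nat.gcd t.1.natAbs q).divisors, quadRootCount (t.1 / e) t.2 (formC h t * e) (q / e)

/-- **Uniform bound**: for `h = a h₀` (`h₀` square-free, `gcd(a,h₀) = 1`), a form `(A, B)` of
discriminant `−4h` with `A ≥ 1`, and `q ≥ 1`:
`levelMultBound ≤ τ(q) · 4^{ω(q)} · a²` (each quadratic `(A/e)u² + Bu + Ce` has `B = 2b`,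
`(A/e)(Ce) − b² = h`, content dividing `a`, and `p^{2j} ∣ h ⇒ p^j ∣ a`).
[cite: GrimmeltMerikoski2025, §4.1 ("≪ gcd(𝔞₂,𝔟₂,𝔠₂,q) d(q)")] -/
theorem levelMultBound_le {a h₀ : ℕ} (ha : 0 < a) (hh₀ : 0 < h₀) (hsq : Squarefree h₀)
    (hcop : a.Coprime h₀) {t : ℤ × ℤ} (ht4 : (4 * t.1) ∣ t.2 ^ 2 + 4 * (a * h₀ : ℕ))
    {q : ℕ} (hq : 0 < q) :
    levelMultBound (a * h₀) q t ≤ #q.divisors * (4 ^ q.primeFactors.card * a * a) := by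
  set h : ℕ := a * h₀ with hhdef
  have hh : 0 < h := Nat.mul_pos ha hh₀
  -- `B` is even
  have h4 : (4 : ℤ) ∣ t.2 ^ 2 + 4 * h := (dvd_mul_right 4 t.1).trans ht4
  have h2B : (2 : ℤ) ∣ t.2 := by
    have h4' : (4 : ℤ) ∣ t.2 ^ 2 := by
      have := dvd_sub h4 (dvd_mul_right 4 (h : ℤ)); rwa [add_sub_cancel_right] at this
    exact Int.prime_two.dvd_of_dvd_pow ((show (2:ℤ) ∣ 4 by norm_num).trans h4')
  obtain ⟨b, hb⟩ := h2B
  have hAC : t.1 * formC h t = b ^ 2 + h := by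
    have := formC_spec ht4
    rw [hb] at this
    linarith
  unfold levelMultBound
  have hterm : ∀ e ∈ (Nat.gcd t.1.natAbs q).divisors,
      quadRootCount (t.1 / e) t.2 (formC h t * e) (q / e) ≤ 4 ^ q.primeFactors.card * a * a := by
    intro e he
    rw [Nat.mem_divisors] at he
    have heA : (e : ℤ) ∣ t.1 := Int.natCast_dvd.mpr (he.1.trans (Nat.gcd_dvd_left _ _))
    have heq : e ∣ q := he.1.trans (Nat.gcd_dvd_right _ _)
    have he0 : 0 < e := Nat.pos_of_dvd_of_pos heq hq
    have hqe : 0 < q / e := Nat.div_pos (Nat.le_of_dvd hq heq) he0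
    -- the value `(A/e)(Ce) − b² = h`
    have hval : t.1 / e * (formC h t * e) - b ^ 2 = (h : ℤ) := by
      rw [show t.1 / e * (formC h t * e) = (t.1 / e * e) * formC h t by ring, Int.ediv_mul_cancel heA]
      linarith
    have hval0 : t.1 / e * (formC h t * e) - b ^ 2 ≠ 0 := by
      rw [hval]; exact_mod_cast hh.ne'
    -- the content divides `a`
    have hG : (Int.gcd (Int.gcd (t.1 / e) b) (formC h t * e) : ℤ) ∣ (a : ℤ) := by
      set g : ℕ := Int.gcd (Int.gcd (t.1 / e) b) (formC h t * e) with hg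
      have hg1 : (g : ℤ) ∣ t.1 / e := (Int.gcd_dvd_left _ _).trans (Int.gcd_dvd_left _ _)
      have hg2 : (g : ℤ) ∣ b := (Int.gcd_dvd_left _ _).trans (Int.gcd_dvd_right _ _)
      have hg3 : (g : ℤ) ∣ formC h t * e := Int.gcd_dvd_right _ _
      have hg4 : ((g : ℤ)) ^ 2 ∣ t.1 / e * (formC h t * e) - b ^ 2 := by
        rw [pow_two]
        exact dvd_sub (mul_dvd_mul hg1 hg3) (mul_dvd_mul hg2 hg2 |>.trans (by rw [pow_two]))
      rw [hval] at hg4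
      have hg5 : g ^ 2 ∣ a * h₀ := by
        have : ((g ^ 2 : ℕ) : ℤ) ∣ ((a * h₀ : ℕ) : ℤ) := by push_cast; exact_mod_cast hg4
        exact Int.natCast_dvd_natCast.mp this
      exact Int.natCast_dvd_natCast.mpr (dvd_of_sq_dvd_mul hsq hcop hg5)
    have hE : ∀ (p j : ℕ), p.Prime → (p : ℤ) ^ (2 * j) ∣ t.1 / e * (formC h t * e) - b ^ 2 → p ^ j ∣ a := by
      intro p j hp hpdvd
      rw [hval] at hpdvd
      exact pow_dvd_of_pow_two_mul_dvd hsq hcop hp hpdvd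
    have hmain := quadRootCount_le_of_gcd_of_sq (α := t.1 / e) (β := b) (γ := formC h t * e)
      hval0 ha.ne' ha.ne' hG hE hqe
    rw [hb, show (2 : ℤ) * b = 2 * b from rfl]
    refine hmain.trans ?_
    have hω : (q / e).primeFactors.card ≤ q.primeFactors.card :=
      card_le_card (Nat.primeFactors_mono (Nat.div_dvd_of_dvd heq) hq.ne')
    have := Nat.pow_le_pow_right (by norm_num : 0 < 4) hω
    exact Nat.mul_le_mul_right _ (Nat.mul_le_mul_right _ this)
  calc ∑ e ∈ (Nat.gcd t.1.natAbs q).divisors, quadRootCount (t.1 / e) t.2 (formC h t * e) (q / e)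
      ≤ ∑ e ∈ (Nat.gcd t.1.natAbs q).divisors, 4 ^ q.primeFactors.card * a * a := sum_le_sum hterm
    _ = #(Nat.gcd t.1.natAbs q).divisors * (4 ^ q.primeFactors.card * a * a) := by
        rw [sum_const, smul_eq_mul]
    _ ≤ #q.divisors * (4 ^ q.primeFactors.card * a * a) :=
        Nat.mul_le_mul_right _ (card_le_card (Nat.divisors_subset_of_dvd hq.ne' (Nat.gcd_dvd_right _ _)))

/-- Real form: `levelMultBound ≤ C³ q^{3η} a²` whenever `τ(n) ≤ C n^η` (`η ≥ 0`). [folklore] -/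
theorem levelMultBound_le_rpow {a h₀ : ℕ} (ha : 0 < a) (hh₀ : 0 < h₀) (hsq : Squarefree h₀)
    (hcop : a.Coprime h₀) {t : ℤ × ℤ} (ht4 : (4 * t.1) ∣ t.2 ^ 2 + 4 * (a * h₀ : ℕ))
    {η C : ℝ} (hC : ∀ n : ℕ, (#n.divisors : ℝ) ≤ C * (n : ℝ) ^ η) {q : ℕ} (hq : 0 < q) :
    (levelMultBound (a * h₀) q t : ℝ) ≤ C ^ 3 * (q : ℝ) ^ (3 * η) * a ^ 2 := by
  have h1 : (levelMultBound (a * h₀) q t : ℝ) ≤ (#q.divisors : ℝ) * ((4 : ℝ) ^ q.primeFactors.card * a * a) := by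
    exact_mod_cast levelMultBound_le ha hh₀ hsq hcop ht4 hq
  have h2 := four_pow_card_primeFactors_le hq.ne'
  have h3 := hC q
  have hC0 : 0 ≤ C := by have := hC 1; simp at this; linarith
  have hτ0 : (0 : ℝ) ≤ #q.divisors := Nat.cast_nonneg _
  have ha0 : (0 : ℝ) ≤ a := Nat.cast_nonneg _
  have h4 : (#q.divisors : ℝ) * ((4 : ℝ) ^ q.primeFactors.card * a * a) ≤ (C * (q : ℝ) ^ η) ^ 3 * a ^ 2 := by
    calc (#q.divisors : ℝ) * ((4 : ℝ) ^ q.primeFactors.card * a * a)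
        ≤ (#q.divisors : ℝ) * ((#q.divisors : ℝ) ^ 2 * a * a) := by gcongr
      _ = (#q.divisors : ℝ) ^ 3 * a ^ 2 := by ring
      _ ≤ (C * (q : ℝ) ^ η) ^ 3 * a ^ 2 := by gcongr
  have h5 : (C * (q : ℝ) ^ η) ^ 3 = C ^ 3 * (q : ℝ) ^ (3 * η) := by
    rw [mul_pow, show (3 : ℝ) * η = η * (3 : ℕ) by push_cast; ring, Real.rpow_mul_natCast (Nat.cast_nonneg _)]
  rw [h5] at h4
  exact h1.trans h4

end levelMult


section assembly

/-- **The level weight** of a pair `(s, t)` at level `q`: the multiplicity bound of `t` if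
`s = t` or `q ∣ Res(s, t)`, else `0` — an upper bound (assembly layer) for the number of cosets
`τ ∈ Γ₀(q)∖SL₂(ℤ)` at which both forms have level `q`.
[cite: GrimmeltMerikoski2025, §4.1.1–4.1.2 (∑_τ α_q(τw₁)α_q(τz₂) ≪ … 𝟙_{F(w₁,z₂) ≡ 0 (mod q)})] -/
def levelWeight (h q : ℕ) (s : ℕ × ℤ) (t : ℤ × ℤ) : ℝ :=
  if ((s.1 : ℤ), s.2) = t ∨ (q : ℤ) ∣ resPair h ((s.1 : ℤ), s.2) t then (levelMultBound h q t : ℝ) else 0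

/-- `levelWeight ≥ 0`. [folklore] -/
theorem levelWeight_nonneg (h q : ℕ) (s : ℕ × ℤ) (t : ℤ × ℤ) : 0 ≤ levelWeight h q s t := by
  unfold levelWeight; split_ifs
  · exact Nat.cast_nonneg _
  · exact le_rfl

/-- **Summing the level weight over `q ≤ Q`**: at most `C³Q^{3η}a²` times `Q` on the diagonal
`s = t`, and times `τ(Res(s,t))` off it (`Res > 0`, and `#{q ≤ Q : q ∣ Res} ≤ τ(Res)`).
[cite: GrimmeltMerikoski2025, §4.1.1 (diagonal: the sum over d gives a factor D) and §4.1.2 (off-diagonal: divisor bound absorbs the sum over q ∣ F(w₁,z₂) ≠ 0)] -/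
theorem sum_levelWeight_le {a h₀ : ℕ} (ha : 0 < a) (hh₀ : 0 < h₀) (hsq : Squarefree h₀)
    (hcop : a.Coprime h₀) {η C : ℝ} (hη : 0 ≤ η) (hC : ∀ n : ℕ, (#n.divisors : ℝ) ≤ C * (n : ℝ) ^ η)
    {t : ℤ × ℤ} (ht1 : 0 < t.1) (ht4 : (4 * t.1) ∣ t.2 ^ 2 + 4 * (a * h₀ : ℕ))
    {s : ℕ × ℤ} (hs1 : 0 < s.1) (hs4 : (4 * (s.1 : ℤ)) ∣ s.2 ^ 2 + 4 * (a * h₀ : ℕ)) (Q : ℕ) :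
    ∑ q ∈ Icc 1 Q, levelWeight (a * h₀) q s t ≤
      C ^ 3 * (Q : ℝ) ^ (3 * η) * a ^ 2 *
        (if ((s.1 : ℤ), s.2) = t then (Q : ℝ)
          else #((resPair (a * h₀) ((s.1 : ℤ), s.2) t).natAbs.divisors)) := by
  set h : ℕ := a * h₀ with hhdef
  have hh : 0 < h := Nat.mul_pos ha hh₀
  set Lb : ℝ := C ^ 3 * (Q : ℝ) ^ (3 * η) * a ^ 2 with hLb
  have hC0 : 0 ≤ C := by have := hC 1; simp at this; linarith
  have hLb0 : 0 ≤ Lb := by positivity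
  have hLq : ∀ q ∈ Icc 1 Q, (levelMultBound h q t : ℝ) ≤ Lb := by
    intro q hq
    rw [mem_Icc] at hq
    refine (levelMultBound_le_rpow ha hh₀ hsq hcop ht4 hC (by omega : 0 < q)).trans ?_
    rw [hLb]
    have : (q : ℝ) ^ (3 * η) ≤ (Q : ℝ) ^ (3 * η) :=
      Real.rpow_le_rpow (Nat.cast_nonneg _) (by exact_mod_cast hq.2) (by linarith)
    have hC3 : 0 ≤ C ^ 3 := by positivity
    nlinarith [mul_le_mul_of_nonneg_left this hC3, sq_nonneg (a : ℝ)]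
  set s' : ℤ × ℤ := ((s.1 : ℤ), s.2) with hs'
  by_cases hst : s' = t
  · rw [if_pos hst]
    calc ∑ q ∈ Icc 1 Q, levelWeight h q s t ≤ ∑ q ∈ Icc 1 Q, Lb := by
          refine sum_le_sum fun q hq => ?_
          unfold levelWeight
          rw [if_pos (Or.inl hst)]
          exact hLq q hq
      _ = Lb * Q := by rw [sum_const, Nat.card_Icc, Nat.add_sub_cancel, nsmul_eq_mul, mul_comm]
  · rw [if_neg hst]
    have hres : 0 < resPair h s' t :=
      resPair_pos hh (by simpa [hs'] using hs1) ht1 hs4 ht4 hst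
    calc ∑ q ∈ Icc 1 Q, levelWeight h q s t
        ≤ ∑ q ∈ Icc 1 Q, (if (q : ℤ) ∣ resPair h s' t then Lb else 0) := by
          refine sum_le_sum fun q hq => ?_
          unfold levelWeight
          rw [← hs']
          split_ifs with h1 h2 h2
          · exact hLq q hq
          · exact absurd (h1.resolve_left hst) h2
          · exact hLb0
          · exact le_rfl
      _ = Lb * #((Icc 1 Q).filter (fun q : ℕ => (q : ℤ) ∣ resPair h s' t)) := by
          rw [← sum_filter, sum_const, nsmul_eq_mul, mul_comm]
      _ ≤ Lb * #((resPair h s' t).natAbs.divisors) := by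
          refine mul_le_mul_of_nonneg_left ?_ hLb0
          exact_mod_cast card_filter_dvd_le Q hres.ne'

/-- **One pair**: `k⁺(u(s,t)) ∑_q levelWeight ≤ C³Q^{3η}a² (Q·𝟙[s = t] + C(16h²Z(Z+1))^η k⁺(u(s,t)))`
(off the diagonal `k⁺ ≠ 0` forces `u ≤ Z`, so `0 < Res ≤ 16h²Z(Z+1)` and `τ(Res) ≤ C Res^η`).
[cite: GrimmeltMerikoski2025, §4.1.2] -/
theorem kPlus_mul_sum_levelWeight_le {a h₀ : ℕ} (ha : 0 < a) (hh₀ : 0 < h₀) (hsq : Squarefree h₀)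
    (hcop : a.Coprime h₀) {η C : ℝ} (hη : 0 ≤ η) (hC : ∀ n : ℕ, (#n.divisors : ℝ) ≤ C * (n : ℝ) ^ η)
    {t : ℤ × ℤ} (ht1 : 0 < t.1) (ht4 : (4 * t.1) ∣ t.2 ^ 2 + 4 * (a * h₀ : ℕ))
    {s : ℕ × ℤ} (hs1 : 0 < s.1) (hs4 : (4 * (s.1 : ℤ)) ∣ s.2 ^ 2 + 4 * (a * h₀ : ℕ)) (Q : ℕ)
    {Z : ℝ} (hZ : 0 ≤ Z) :
    kPlus Z (uPair (a * h₀) ((s.1 : ℤ), s.2) t) * ∑ q ∈ Icc 1 Q, levelWeight (a * h₀) q s t ≤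
      C ^ 3 * (Q : ℝ) ^ (3 * η) * a ^ 2 *
        ((if ((s.1 : ℤ), s.2) = t then (Q : ℝ) else 0) +
          C * (16 * ((a * h₀ : ℕ) : ℝ) ^ 2 * Z * (Z + 1)) ^ η * kPlus Z (uPair (a * h₀) ((s.1 : ℤ), s.2) t)) := by
  set h : ℕ := a * h₀ with hhdef
  have hh : 0 < h := Nat.mul_pos ha hh₀
  set s' : ℤ × ℤ := ((s.1 : ℤ), s.2) with hs'
  set k := kPlus Z (uPair h s' t) with hk
  have hk0 : 0 ≤ k := kPlus_nonneg _ _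
  have hk1 : k ≤ 1 := kPlus_le_one (uPair_nonneg (by simpa [hs'] using hs1) ht1)
  have hC0 : 0 ≤ C := by have := hC 1; simp at this; linarith
  set Lb : ℝ := C ^ 3 * (Q : ℝ) ^ (3 * η) * a ^ 2 with hLb
  have hLb0 : 0 ≤ Lb := by positivity
  have hsum := sum_levelWeight_le ha hh₀ hsq hcop hη hC ht1 ht4 hs1 hs4 Q
  rw [← hs', ← hLb] at hsum
  by_cases hst : s' = t
  · rw [if_pos hst] at hsum ⊢
    calc k * ∑ q ∈ Icc 1 Q, levelWeight h q s t ≤ 1 * (Lb * Q) :=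
          mul_le_mul hk1 hsum (sum_nonneg fun q _ => levelWeight_nonneg _ _ _ _) zero_le_one
      _ ≤ Lb * (Q + C * (16 * (h : ℝ) ^ 2 * Z * (Z + 1)) ^ η * k) := by
          rw [one_mul, mul_add]
          have : 0 ≤ Lb * (C * (16 * (h : ℝ) ^ 2 * Z * (Z + 1)) ^ η * k) := by positivity
          linarith
  · rw [if_neg hst] at hsum ⊢
    rw [zero_add]
    rcases eq_or_lt_of_le hk0 with hk00 | hkpos
    · rw [← hk00, zero_mul]; positivity
    · -- `k ≠ 0`: `u ≤ Z`
      have hu : uPair h s' t ≤ Z := by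
        by_contra hu
        rw [hk, kPlus_eq_zero_of_lt (not_le.mp hu)] at hkpos
        exact lt_irrefl _ hkpos
      have hres0 : 0 < resPair h s' t :=
        resPair_pos hh (by simpa [hs'] using hs1) ht1 hs4 ht4 hst
      have hresle := resPair_le hh (by simpa [hs'] using hs1) ht1 hs4 ht4 hZ hu
      have hτ : (#((resPair h s' t).natAbs.divisors) : ℝ) ≤ C * (16 * (h : ℝ) ^ 2 * Z * (Z + 1)) ^ η := by
        refine (hC _).trans (mul_le_mul_of_nonneg_left ?_ hC0)
        refine Real.rpow_le_rpow (Nat.cast_nonneg _) ?_ hη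
        rw [Nat.cast_natAbs, Int.cast_abs, abs_of_pos (by exact_mod_cast hres0)]
        exact hresle
      calc k * ∑ q ∈ Icc 1 Q, levelWeight h q s t ≤ k * (Lb * #((resPair h s' t).natAbs.divisors)) :=
            mul_le_mul_of_nonneg_left hsum hk0
        _ ≤ k * (Lb * (C * (16 * (h : ℝ) ^ 2 * Z * (Z + 1)) ^ η)) := by gcongr
        _ = Lb * (C * (16 * (h : ℝ) ^ 2 * Z * (Z + 1)) ^ η * k) := by ring

/-- At most one `s ∈ discPairs` coincides with `t`. [folklore] -/
theorem sum_ite_eq_le_one (h N N' : ℕ) (t : ℤ × ℤ) (Q : ℝ) (hQ : 0 ≤ Q) :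
    ∑ s ∈ discPairs h N N', (if ((s.1 : ℤ), s.2) = t then Q else 0) ≤ Q := by
  rw [← sum_filter]
  have hcard : #((discPairs h N N').filter (fun s : ℕ × ℤ => ((s.1 : ℤ), s.2) = t)) ≤ 1 := by
    refine card_le_one.mpr fun s hs s₂ hs₂ => ?_
    rw [mem_filter] at hs hs₂
    have := hs.2.trans hs₂.2.symm
    simp only [Prod.mk.injEq, Nat.cast_inj] at this
    exact Prod.ext this.1 this.2
  rw [sum_const, nsmul_eq_mul]
  calc (#((discPairs h N N').filter (fun s : ℕ × ℤ => ((s.1 : ℤ), s.2) = t)) : ℝ) * Q ≤ 1 * Q := by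
        refine mul_le_mul_of_nonneg_right ?_ hQ
        exact_mod_cast hcard
    _ = Q := one_mul Q

/-- **The sum over all forms `s` for a fixed reduced `t`**:
`∑_s k⁺ ∑_q levelWeight ≤ C³Q^{3η}a² (Q + C(16h²Z(Z+1))^η ∑_{A ≤ N} rowSum)`. [cite: GrimmeltMerikoski2025, §4.1] -/
theorem sum_discPairs_le {a h₀ : ℕ} (ha : 0 < a) (hh₀ : 0 < h₀) (hsq : Squarefree h₀)
    (hcop : a.Coprime h₀) {η C : ℝ} (hη : 0 ≤ η) (hC : ∀ n : ℕ, (#n.divisors : ℝ) ≤ C * (n : ℝ) ^ η)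
    {t : ℤ × ℤ} (ht1 : 0 < t.1) (ht4 : (4 * t.1) ∣ t.2 ^ 2 + 4 * (a * h₀ : ℕ)) (Q : ℕ)
    {Z : ℝ} (hZ : 0 ≤ Z) (N N' : ℕ) :
    ∑ s ∈ discPairs (a * h₀) N N',
        kPlus Z (uPair (a * h₀) ((s.1 : ℤ), s.2) t) * ∑ q ∈ Icc 1 Q, levelWeight (a * h₀) q s t ≤
      C ^ 3 * (Q : ℝ) ^ (3 * η) * a ^ 2 *
        ((Q : ℝ) + C * (16 * ((a * h₀ : ℕ) : ℝ) ^ 2 * Z * (Z + 1)) ^ η *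
          ∑ A ∈ Icc 1 N, rowSum (a * h₀) Z t A N') := by
  set h : ℕ := a * h₀ with hhdef
  have hC0 : 0 ≤ C := by have := hC 1; simp at this; linarith
  set Lb : ℝ := C ^ 3 * (Q : ℝ) ^ (3 * η) * a ^ 2 with hLb
  set K : ℝ := C * (16 * (h : ℝ) ^ 2 * Z * (Z + 1)) ^ η with hK
  have hterm : ∀ s ∈ discPairs h N N',
      kPlus Z (uPair h ((s.1 : ℤ), s.2) t) * ∑ q ∈ Icc 1 Q, levelWeight h q s t ≤
        Lb * ((if ((s.1 : ℤ), s.2) = t then (Q : ℝ) else 0) + K * kPlus Z (uPair h ((s.1 : ℤ), s.2) t)) := by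
    intro s hs
    rw [mem_discPairs] at hs
    exact kPlus_mul_sum_levelWeight_le ha hh₀ hsq hcop hη hC ht1 ht4 (by omega) hs.2.2 Q hZ
  calc ∑ s ∈ discPairs h N N', kPlus Z (uPair h ((s.1 : ℤ), s.2) t) * ∑ q ∈ Icc 1 Q, levelWeight h q s t
      ≤ ∑ s ∈ discPairs h N N',
          Lb * ((if ((s.1 : ℤ), s.2) = t then (Q : ℝ) else 0) + K * kPlus Z (uPair h ((s.1 : ℤ), s.2) t)) :=
        sum_le_sum hterm
    _ = Lb * (∑ s ∈ discPairs h N N', (if ((s.1 : ℤ), s.2) = t then (Q : ℝ) else 0) +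
          K * ∑ s ∈ discPairs h N N', kPlus Z (uPair h ((s.1 : ℤ), s.2) t)) := by
        rw [← mul_sum, sum_add_distrib, ← mul_sum]
    _ ≤ Lb * ((Q : ℝ) + K * ∑ A ∈ Icc 1 N, rowSum h Z t A N') := by
        rw [sum_discPairs_eq_sum_rowSum]
        have hLb0 : 0 ≤ Lb := by positivity
        refine mul_le_mul_of_nonneg_left (add_le_add (sum_ite_eq_le_one h N N' t Q (Nat.cast_nonneg Q)) le_rfl) hLb0

/-- **All rows for a reduced `t`** (`A_t ≤ 2√h`): near + far with `t.1` replaced by `2√h`,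
`M* = (2 + 4Z)·2√h`.  [cite: GrimmeltMerikoski2025, §4.1.2] -/
theorem sum_rowSum_le_of_mem_heegnerReps {a h₀ : ℕ} (ha : 0 < a) (hh₀ : 0 < h₀) (hsq : Squarefree h₀)
    (hcop : a.Coprime h₀) {η C : ℝ} (hη : 0 ≤ η) (hC : ∀ n : ℕ, (#n.divisors : ℝ) ≤ C * (n : ℝ) ^ η)
    {t : ℤ × ℤ} (ht : t ∈ heegnerReps (a * h₀)) {Z : ℝ} (hZ : 0 ≤ Z) (N N' : ℕ) :
    ∑ A ∈ Icc 1 N, rowSum (a * h₀) Z t A N' ≤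
      C ^ 2 * a * (20 * Real.sqrt ((a * h₀ : ℕ) : ℝ)) ^ (2 * η) *
          (8 * Real.sqrt (10 * ((a * h₀ : ℕ) : ℝ) * Z) + 40 * Real.sqrt ((a * h₀ : ℕ) : ℝ)) +
        C ^ 2 * a * ((2 + 4 * Z) * (2 * Real.sqrt ((a * h₀ : ℕ) : ℝ))) ^ (2 * η) *
          (12 * Real.sqrt (((a * h₀ : ℕ) : ℝ) * Z) * (1 + Real.log ((2 + 4 * Z) * (2 * Real.sqrt ((a * h₀ : ℕ) : ℝ)) + 1)) +
            12 * Real.sqrt (2 * Real.sqrt ((a * h₀ : ℕ) : ℝ)) * Real.sqrt ((2 + 4 * Z) * (2 * Real.sqrt ((a * h₀ : ℕ) : ℝ)))) := by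
  set h : ℕ := a * h₀ with hhdef
  set sh : ℝ := Real.sqrt (h : ℝ) with hsh
  have hsh0 : 0 ≤ sh := Real.sqrt_nonneg _
  obtain ⟨ht1, ht4, -, -, -⟩ := mem_heegnerReps ht
  have ht1' : 0 < t.1 := by omega
  have htle : (t.1 : ℝ) ≤ 2 * sh := fst_le_two_sqrt_of_mem_heegnerReps ht
  have ht0 : (0 : ℝ) < t.1 := by exact_mod_cast ht1'
  have hC0 : 0 ≤ C := by have := hC 1; simp at this; linarith
  set M₁ : ℕ := 10 * t.1.toNat with hM₁
  -- split the rows at `10 A_t`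
  have hsplit : ∑ A ∈ Icc 1 N, rowSum h Z t A N' =
      ∑ A ∈ (Icc 1 N).filter (fun A => A ≤ M₁), rowSum h Z t A N' +
        ∑ A ∈ (Icc 1 N).filter (fun A : ℕ => 10 * t.1.toNat < A), rowSum h Z t A N' := by
    rw [← sum_filter_add_sum_filter_not (Icc 1 N) (fun A => A ≤ M₁)]
    congr 1
    exact sum_congr (filter_congr fun A _ => by rw [hM₁, not_le]) fun _ _ => rfl
  have hnear_sub : (Icc 1 N).filter (fun A => A ≤ M₁) ⊆ Icc 1 M₁ := by
    intro A hA
    rw [mem_filter, mem_Icc] at hA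
    exact mem_Icc.mpr ⟨hA.1.1, hA.2⟩
  have hnear := sum_rowSum_near_le ha hh₀ hsq hcop hη hC ht1' hZ N' (t := t)
  have hfar := sum_rowSum_far_le ha hh₀ hsq hcop hη hC ht1' hZ N N' (t := t)
  rw [hsplit]
  refine add_le_add ((sum_le_sum_of_subset_of_nonneg hnear_sub fun A _ _ => rowSum_nonneg _ _ _ _ _).trans
    (hnear.trans ?_)) (hfar.trans ?_)
  · -- near: `10 A_t ≤ 20√h`, `20 A_t ≤ 40√h`
    have h1 : (10 * (t.1 : ℝ)) ^ (2 * η) ≤ (20 * sh) ^ (2 * η) :=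
      Real.rpow_le_rpow (by positivity) (by linarith) (by linarith)
    have h2 : 8 * Real.sqrt (10 * (h : ℝ) * Z) + 20 * t.1 ≤ 8 * Real.sqrt (10 * (h : ℝ) * Z) + 40 * sh := by
      linarith
    have h3 : 0 ≤ 8 * Real.sqrt (10 * (h : ℝ) * Z) + 20 * t.1 := by positivity
    calc C ^ 2 * a * (10 * (t.1 : ℝ)) ^ (2 * η) * (8 * Real.sqrt (10 * (h : ℝ) * Z) + 20 * t.1)
        ≤ C ^ 2 * a * (20 * sh) ^ (2 * η) * (8 * Real.sqrt (10 * (h : ℝ) * Z) + 20 * t.1) :=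
          mul_le_mul_of_nonneg_right (mul_le_mul_of_nonneg_left h1 (by positivity)) h3
      _ ≤ C ^ 2 * a * (20 * sh) ^ (2 * η) * (8 * Real.sqrt (10 * (h : ℝ) * Z) + 40 * sh) :=
          mul_le_mul_of_nonneg_left h2 (by positivity)
  · -- far: `M₂ ≤ M* = (2+4Z) 2√h`
    set M₂ : ℕ := ⌊(2 + 4 * Z) * t.1⌋₊ with hM₂
    set Mst : ℝ := (2 + 4 * Z) * (2 * sh) with hMst
    have hM₂le : (M₂ : ℝ) ≤ Mst := by
      refine (Nat.floor_le (by positivity)).trans ?_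
      rw [hMst]
      exact mul_le_mul_of_nonneg_left htle (by positivity)
    have hMst0 : 0 ≤ Mst := by positivity
    have h1 : (M₂ : ℝ) ^ (2 * η) ≤ Mst ^ (2 * η) := Real.rpow_le_rpow (Nat.cast_nonneg _) hM₂le (by linarith)
    have h2 : Real.log ((M₂ : ℝ) + 1) ≤ Real.log (Mst + 1) := Real.log_le_log (by positivity) (by linarith)
    have h3 : Real.sqrt (M₂ : ℝ) ≤ Real.sqrt Mst := Real.sqrt_le_sqrt hM₂le
    have h4 : Real.sqrt (t.1 : ℝ) ≤ Real.sqrt (2 * sh) := Real.sqrt_le_sqrt htle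
    have hlog0 : 0 ≤ 1 + Real.log ((M₂ : ℝ) + 1) := by
      have : 0 ≤ Real.log ((M₂ : ℝ) + 1) := Real.log_nonneg (by linarith [(Nat.cast_nonneg M₂ : (0:ℝ) ≤ M₂)])
      linarith
    have hin : 12 * Real.sqrt ((h : ℝ) * Z) * (1 + Real.log ((M₂ : ℝ) + 1)) + 12 * Real.sqrt (t.1 : ℝ) * Real.sqrt (M₂ : ℝ) ≤
        12 * Real.sqrt ((h : ℝ) * Z) * (1 + Real.log (Mst + 1)) + 12 * Real.sqrt (2 * sh) * Real.sqrt Mst := by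
      refine add_le_add (mul_le_mul_of_nonneg_left (by linarith) (by positivity)) ?_
      exact mul_le_mul (mul_le_mul_of_nonneg_left h4 (by norm_num)) h3 (Real.sqrt_nonneg _) (by positivity)
    have hin0 : 0 ≤ 12 * Real.sqrt ((h : ℝ) * Z) * (1 + Real.log ((M₂ : ℝ) + 1)) + 12 * Real.sqrt (t.1 : ℝ) * Real.sqrt (M₂ : ℝ) := by
      positivity
    calc C ^ 2 * a * (M₂ : ℝ) ^ (2 * η) *
          (12 * Real.sqrt ((h : ℝ) * Z) * (1 + Real.log ((M₂ : ℝ) + 1)) + 12 * Real.sqrt (t.1 : ℝ) * Real.sqrt (M₂ : ℝ))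
        ≤ C ^ 2 * a * Mst ^ (2 * η) *
          (12 * Real.sqrt ((h : ℝ) * Z) * (1 + Real.log ((M₂ : ℝ) + 1)) + 12 * Real.sqrt (t.1 : ℝ) * Real.sqrt (M₂ : ℝ)) :=
          mul_le_mul_of_nonneg_right (mul_le_mul_of_nonneg_left h1 (by positivity)) hin0
      _ ≤ C ^ 2 * a * Mst ^ (2 * η) *
          (12 * Real.sqrt ((h : ℝ) * Z) * (1 + Real.log (Mst + 1)) + 12 * Real.sqrt (2 * sh) * Real.sqrt Mst) :=
          mul_le_mul_of_nonneg_left hin (by positivity)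

/-- **Proposition 4.1 of [GrimmeltMerikoski2025] in arithmetic form (explicit version).**
For `h = ah₀` (`h₀` square-free, `gcd(a, h₀) = 1`), `Q ≥ 1`, `Z ≥ 0` and any box `N, N'`:
`∑_{q ≤ Q} ∑_{t ∈ Λ_h} ∑_{s} k⁺_Z(u(s,t)) · levelWeight(q,s,t)`
`  ≤ #Λ-bound · C³Q^{3η}a² · (Q + C(16h²Z(Z+1))^η · (near* + far*))`, with `τ(n) ≤ C n^η`.
[cite: GrimmeltMerikoski2025, Proposition 4.1 and its proof §4.1] -/
theorem heegnerKernel_sum_le_explicit {a h₀ : ℕ} (ha : 0 < a) (hh₀ : 0 < h₀) (hsq : Squarefree h₀)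
    (hcop : a.Coprime h₀) {η C : ℝ} (hη : 0 ≤ η) (hC : ∀ n : ℕ, (#n.divisors : ℝ) ≤ C * (n : ℝ) ^ η)
    (Q : ℕ) {Z : ℝ} (hZ : 0 ≤ Z) (N N' : ℕ) :
    ∑ q ∈ Icc 1 Q, ∑ t ∈ heegnerReps (a * h₀), ∑ s ∈ discPairs (a * h₀) N N',
        kPlus Z (uPair (a * h₀) ((s.1 : ℤ), s.2) t) * levelWeight (a * h₀) q s t ≤
      (3 * C ^ 2 * a * (2 * Real.sqrt ((a * h₀ : ℕ) : ℝ) + 1) ^ (1 + 2 * η)) *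
        (C ^ 3 * (Q : ℝ) ^ (3 * η) * a ^ 2 *
          ((Q : ℝ) + C * (16 * ((a * h₀ : ℕ) : ℝ) ^ 2 * Z * (Z + 1)) ^ η *
            (C ^ 2 * a * (20 * Real.sqrt ((a * h₀ : ℕ) : ℝ)) ^ (2 * η) *
                (8 * Real.sqrt (10 * ((a * h₀ : ℕ) : ℝ) * Z) + 40 * Real.sqrt ((a * h₀ : ℕ) : ℝ)) +
              C ^ 2 * a * ((2 + 4 * Z) * (2 * Real.sqrt ((a * h₀ : ℕ) : ℝ))) ^ (2 * η) *
                (12 * Real.sqrt (((a * h₀ : ℕ) : ℝ) * Z) *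
                    (1 + Real.log ((2 + 4 * Z) * (2 * Real.sqrt ((a * h₀ : ℕ) : ℝ)) + 1)) +
                  12 * Real.sqrt (2 * Real.sqrt ((a * h₀ : ℕ) : ℝ)) *
                    Real.sqrt ((2 + 4 * Z) * (2 * Real.sqrt ((a * h₀ : ℕ) : ℝ))))))) := by
  set h : ℕ := a * h₀ with hhdef
  have hC0 : 0 ≤ C := by have := hC 1; simp at this; linarith
  -- reorder the sums
  rw [sum_comm]
  have hreorder : ∀ t ∈ heegnerReps h,
      ∑ q ∈ Icc 1 Q, ∑ s ∈ discPairs h N N', kPlus Z (uPair h ((s.1 : ℤ), s.2) t) * levelWeight h q s t =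
        ∑ s ∈ discPairs h N N', kPlus Z (uPair h ((s.1 : ℤ), s.2) t) * ∑ q ∈ Icc 1 Q, levelWeight h q s t := by
    intro t _
    rw [sum_comm]
    exact sum_congr rfl fun s _ => (mul_sum _ _ _).symm
  rw [sum_congr rfl hreorder]
  -- the uniform per-`t` bound
  set F : ℝ := C ^ 2 * a * (20 * Real.sqrt (h : ℝ)) ^ (2 * η) *
        (8 * Real.sqrt (10 * (h : ℝ) * Z) + 40 * Real.sqrt (h : ℝ)) +
      C ^ 2 * a * ((2 + 4 * Z) * (2 * Real.sqrt (h : ℝ))) ^ (2 * η) *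
        (12 * Real.sqrt ((h : ℝ) * Z) * (1 + Real.log ((2 + 4 * Z) * (2 * Real.sqrt (h : ℝ)) + 1)) +
          12 * Real.sqrt (2 * Real.sqrt (h : ℝ)) * Real.sqrt ((2 + 4 * Z) * (2 * Real.sqrt (h : ℝ)))) with hF
  set B : ℝ := C ^ 3 * (Q : ℝ) ^ (3 * η) * a ^ 2 * ((Q : ℝ) + C * (16 * (h : ℝ) ^ 2 * Z * (Z + 1)) ^ η * F)
    with hB
  have hper : ∀ t ∈ heegnerReps h,
      ∑ s ∈ discPairs h N N', kPlus Z (uPair h ((s.1 : ℤ), s.2) t) * ∑ q ∈ Icc 1 Q, levelWeight h q s t ≤ B := by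
    intro t ht
    obtain ⟨ht1, ht4, -, -, -⟩ := mem_heegnerReps ht
    have ht1' : 0 < t.1 := by omega
    refine (sum_discPairs_le ha hh₀ hsq hcop hη hC ht1' ht4 Q hZ N N').trans ?_
    rw [hB]
    refine mul_le_mul_of_nonneg_left (add_le_add le_rfl (mul_le_mul_of_nonneg_left ?_ (by positivity))) (by positivity)
    exact sum_rowSum_le_of_mem_heegnerReps ha hh₀ hsq hcop hη hC ht hZ N N'
  have hB0 : 0 ≤ B := by
    have hlog : 0 ≤ 1 + Real.log ((2 + 4 * Z) * (2 * Real.sqrt (h : ℝ)) + 1) := by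
      have : 0 ≤ Real.log ((2 + 4 * Z) * (2 * Real.sqrt (h : ℝ)) + 1) :=
        Real.log_nonneg (by nlinarith [Real.sqrt_nonneg (h : ℝ)])
      linarith
    positivity
  calc ∑ t ∈ heegnerReps h, ∑ s ∈ discPairs h N N', kPlus Z (uPair h ((s.1 : ℤ), s.2) t) * ∑ q ∈ Icc 1 Q, levelWeight h q s t
      ≤ ∑ t ∈ heegnerReps h, B := sum_le_sum hper
    _ = #(heegnerReps h) * B := by rw [sum_const, nsmul_eq_mul]
    _ ≤ (3 * C ^ 2 * a * (2 * Real.sqrt (h : ℝ) + 1) ^ (1 + 2 * η)) * B :=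
        mul_le_mul_of_nonneg_right (card_heegnerReps_le ha hh₀ hsq hcop hη hC) hB0

/-- `y ≤ c X^k` with `c, X ≥ 1` gives `y^e ≤ c X^{ke}` for `0 ≤ e ≤ 1`. [folklore] -/
theorem rpow_le_of_le_mul_rpow {y c X k e : ℝ} (hy : 0 ≤ y) (hX : 1 ≤ X) (hc : 1 ≤ c)
    (hyc : y ≤ c * X ^ k) (he0 : 0 ≤ e) (he1 : e ≤ 1) : y ^ e ≤ c * X ^ (k * e) := by
  have hX0 : 0 ≤ X := by linarith
  calc y ^ e ≤ (c * X ^ k) ^ e := Real.rpow_le_rpow hy hyc he0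
    _ = c ^ e * (X ^ k) ^ e := Real.mul_rpow (by linarith) (Real.rpow_nonneg hX0 k)
    _ = c ^ e * X ^ (k * e) := by rw [← Real.rpow_mul hX0]
    _ ≤ c * X ^ (k * e) := by
        refine mul_le_mul_of_nonneg_right ?_ (Real.rpow_nonneg hX0 _)
        calc c ^ e ≤ c ^ (1 : ℝ) := Real.rpow_le_rpow_of_exponent_le hc he1
          _ = c := Real.rpow_one c

set_option maxHeartbeats 1000000 in
/-- **Proposition 4.1 of [GrimmeltMerikoski2025] in arithmetic form.**  For every `ε > 0` there
is `K` such that for all `h = ah₀` (`h₀` square-free, `gcd(a, h₀) = 1`), `Q ≥ 1`, `Z ≥ 1` and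
every box `N, N'`:
`∑_{q ≤ Q} ∑_{t ∈ Λ_h} ∑_{s ∈ 𝒮_h ∩ box} k⁺_Z(u(s,t)) · levelWeight(q, s, t) ≤ K a⁴ (hQZ)^ε (Q h^{1/2} + h Z^{1/2})`
— the bound `∑_{q ∼ Q} ⟨α_q|𝒦_q k_{Z,1}|α_q⟩ ≺≺ Q h^{1/2} + h Z^{1/2}` of the paper for the
majorant kernel `k⁺` (there `Z^{1/2}` for the kernel supported on `u ≤ Z`), summed over all
`q ≤ Q`, with the multiplicity of the level replaced by its arithmetic upper bound `levelWeight`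
and the square-free hypothesis on `gcd(h, q²)` replaced by the factor `a⁴` (`h = ah₀`; in §5 of
the paper the determinant is `ah` with `a ≺≺ 1`).  Proof: `heegnerKernel_sum_le_explicit` with
`τ(n) ≤ C n^η`, `η = min(ε,1)/9`, and `log x ≤ x^η/η`.
[cite: GrimmeltMerikoski2025, Proposition 4.1] -/
theorem heegnerKernel_sum_le {ε : ℝ} (hε : 0 < ε) :
    ∃ K : ℝ, 0 < K ∧ ∀ (a h₀ : ℕ), 0 < a → 0 < h₀ → Squarefree h₀ → a.Coprime h₀ →
      ∀ (Q : ℕ), 1 ≤ Q → ∀ (Z : ℝ), 1 ≤ Z → ∀ (N N' : ℕ),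
        ∑ q ∈ Icc 1 Q, ∑ t ∈ heegnerReps (a * h₀), ∑ s ∈ discPairs (a * h₀) N N',
            kPlus Z (uPair (a * h₀) ((s.1 : ℤ), s.2) t) * levelWeight (a * h₀) q s t ≤
          K * (a : ℝ) ^ 4 * (((a * h₀ : ℕ) : ℝ) * Q * Z) ^ ε *
            ((Q : ℝ) * Real.sqrt ((a * h₀ : ℕ) : ℝ) + ((a * h₀ : ℕ) : ℝ) * Real.sqrt Z) := by
  -- exponent for the divisor bound
  set η : ℝ := min ε 1 / 9 with hηdef
  have hmin : 0 < min ε 1 := lt_min hε one_pos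
  have hη0 : 0 < η := by positivity
  have hη1 : η ≤ 1 / 9 := by
    have : min ε 1 ≤ 1 := min_le_right _ _
    rw [hηdef]; linarith
  have h9η : 9 * η ≤ ε := by
    have : min ε 1 ≤ ε := min_le_left _ _
    rw [hηdef]; linarith
  obtain ⟨C, hC1, hC⟩ := exists_card_divisors_le_mul_rpow' hη0
  have hC0 : 0 ≤ C := by linarith
  set Kf : ℝ := 2040 + 144 * (1 + 13 / η) with hKf
  have hKf0 : 0 < Kf := by positivity
  refine ⟨864 * Kf * C ^ 8, by positivity, ?_⟩
  intro a h₀ ha hh₀ hsq hcop Q hQ Z hZ N N'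
  have hZ0 : 0 ≤ Z := by linarith
  set h : ℕ := a * h₀ with hhdef
  have hh : 0 < h := Nat.mul_pos ha hh₀
  have hh1 : (1 : ℝ) ≤ h := by exact_mod_cast hh
  have hQ1 : (1 : ℝ) ≤ Q := by exact_mod_cast hQ
  have ha1 : (1 : ℝ) ≤ a := by exact_mod_cast ha
  set sh : ℝ := Real.sqrt (h : ℝ) with hsh
  have hsh1 : 1 ≤ sh := Real.one_le_sqrt.mpr hh1
  have hsh2 : sh ^ 2 = h := Real.sq_sqrt (by linarith)
  have hshle : sh ≤ h := by nlinarith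
  set X : ℝ := (h : ℝ) * Q * Z with hX
  have hX1 : 1 ≤ X := by
    have : (1 : ℝ) ≤ (h : ℝ) * Q := one_le_mul_of_one_le_of_one_le hh1 hQ1
    exact one_le_mul_of_one_le_of_one_le this hZ
  have hX0 : 0 < X := by linarith
  have hhX : (h : ℝ) ≤ X := by
    have : (h : ℝ) * 1 * 1 ≤ (h : ℝ) * Q * Z := by gcongr
    rw [hX]; linarith
  have hQX : (Q : ℝ) ≤ X := by
    have : 1 * (Q : ℝ) * 1 ≤ (h : ℝ) * Q * Z := by gcongr
    rw [hX]; linarith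
  have hshX : sh ≤ X := hshle.trans hhX
  have hhZ : (h : ℝ) * Z ≤ X := by
    have : (h : ℝ) * 1 * Z ≤ (h : ℝ) * Q * Z := by gcongr
    rw [hX]; linarith
  have hshZX : Z * sh ≤ X := by
    have : Z * sh ≤ Z * h := mul_le_mul_of_nonneg_left hshle hZ0
    nlinarith
  have hXpos : ∀ e : ℝ, 0 < X ^ e := fun e => Real.rpow_pos_of_pos hX0 e
  have hXmono : ∀ {e e' : ℝ}, e ≤ e' → X ^ e ≤ X ^ e' := fun hee' =>
    Real.rpow_le_rpow_of_exponent_le hX1 hee'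
  have hsqrthZ : Real.sqrt ((h : ℝ) * Z) = sh * Real.sqrt Z := Real.sqrt_mul (by positivity) Z
  have hshZ : sh ≤ Real.sqrt ((h : ℝ) * Z) := by
    rw [hsqrthZ]
    have : 1 ≤ Real.sqrt Z := Real.one_le_sqrt.mpr hZ
    nlinarith
  have hsZ0 : 0 ≤ Real.sqrt ((h : ℝ) * Z) := Real.sqrt_nonneg _
  -- the explicit bound
  have hexp := heegnerKernel_sum_le_explicit ha hh₀ hsq hcop hη0.le hC Q hZ0 N N'
  refine hexp.trans ?_
  -- (b1) the number of reduced forms: `≤ 27 C² a sh X^η`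
  have hb1 : 3 * C ^ 2 * a * (2 * sh + 1) ^ (1 + 2 * η) ≤ 27 * C ^ 2 * a * sh * X ^ η := by
    have h1 : 2 * sh + 1 ≤ 3 * sh := by linarith
    have h2 : (2 * sh + 1) ^ (1 + 2 * η) ≤ (3 * sh) ^ (1 + 2 * η) :=
      Real.rpow_le_rpow (by positivity) h1 (by positivity)
    have hsh0 : 0 < sh := by linarith
    have h3 : (3 * sh) ^ (1 + 2 * η) = 3 ^ (1 + 2 * η) * (sh * sh ^ (2 * η)) := by
      rw [Real.mul_rpow (by norm_num) hsh0.le, Real.rpow_add hsh0, Real.rpow_one]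
    have h4 : (3 : ℝ) ^ (1 + 2 * η) ≤ 9 := by
      calc (3 : ℝ) ^ (1 + 2 * η) ≤ 3 ^ (2 : ℝ) := Real.rpow_le_rpow_of_exponent_le (by norm_num) (by linarith)
        _ = 9 := by norm_num
    have h5 : sh ^ (2 * η) ≤ X ^ η := by
      have : sh ^ (2 * η) = (h : ℝ) ^ η := by
        rw [← hsh2, ← Real.rpow_natCast sh 2, ← Real.rpow_mul (by positivity)]; norm_num
      rw [this]
      exact Real.rpow_le_rpow (by positivity) hhX hη0.le
    calc 3 * C ^ 2 * a * (2 * sh + 1) ^ (1 + 2 * η) ≤ 3 * C ^ 2 * a * (3 ^ (1 + 2 * η) * (sh * sh ^ (2 * η))) := by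
          rw [← h3]; exact mul_le_mul_of_nonneg_left h2 (by positivity)
      _ ≤ 3 * C ^ 2 * a * (9 * (sh * X ^ η)) := by
          refine mul_le_mul_of_nonneg_left ?_ (by positivity)
          exact mul_le_mul h4 (mul_le_mul_of_nonneg_left h5 (by positivity)) (by positivity) (by norm_num)
      _ = 27 * C ^ 2 * a * sh * X ^ η := by ring
  -- (b2) `Q^{3η} ≤ X^{3η}`
  have hb2 : C ^ 3 * (Q : ℝ) ^ (3 * η) * a ^ 2 ≤ C ^ 3 * X ^ (3 * η) * a ^ 2 := by
    have : (Q : ℝ) ^ (3 * η) ≤ X ^ (3 * η) := Real.rpow_le_rpow (by positivity) hQX (by positivity)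
    exact mul_le_mul_of_nonneg_right (mul_le_mul_of_nonneg_left this (by positivity)) (by positivity)
  -- (b3) `C (16h²Z(Z+1))^η ≤ C · 32 X^{2η}`
  have hb3 : C * (16 * (h : ℝ) ^ 2 * Z * (Z + 1)) ^ η ≤ C * (32 * X ^ (2 * η)) := by
    refine mul_le_mul_of_nonneg_left ?_ hC0
    have h1 : 16 * (h : ℝ) ^ 2 * Z * (Z + 1) ≤ 32 * X ^ (2 : ℝ) := by
      rw [Real.rpow_two]
      have : ((h : ℝ) * Z) ^ 2 ≤ X ^ 2 := pow_le_pow_left₀ (by positivity) hhZ 2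
      nlinarith
    exact rpow_le_of_le_mul_rpow (by positivity) hX1 (by norm_num) h1 hη0.le (by linarith)
  -- (b4) near: `≤ 1320 C² a X^{2η} √(hZ)`
  have hb4 : C ^ 2 * a * (20 * sh) ^ (2 * η) * (8 * Real.sqrt (10 * (h : ℝ) * Z) + 40 * sh) ≤
      1320 * C ^ 2 * a * X ^ (2 * η) * Real.sqrt ((h : ℝ) * Z) := by
    have h1 : (20 * sh) ^ (2 * η) ≤ 20 * X ^ (2 * η) := by
      have h0 : 20 * sh ≤ 20 * X ^ (1 : ℝ) := by rw [Real.rpow_one]; linarith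
      have h2η : 0 ≤ 2 * η := by linarith
      have := rpow_le_of_le_mul_rpow (by positivity) hX1 (by norm_num) h0 h2η (by linarith)
      rwa [one_mul] at this
    have h2 : 8 * Real.sqrt (10 * (h : ℝ) * Z) + 40 * sh ≤ 66 * Real.sqrt ((h : ℝ) * Z) := by
      have h10 : Real.sqrt (10 * (h : ℝ) * Z) = Real.sqrt 10 * Real.sqrt ((h : ℝ) * Z) := by
        rw [show (10 : ℝ) * h * Z = 10 * (h * Z) by ring, Real.sqrt_mul (by norm_num)]
      have hs10 : Real.sqrt 10 ≤ 13 / 4 := by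
        rw [Real.sqrt_le_left (by norm_num)]; norm_num
      rw [h10]
      have e1 := mul_le_mul_of_nonneg_right hs10 hsZ0
      linarith [e1, hshZ]
    have h3 : 0 ≤ 8 * Real.sqrt (10 * (h : ℝ) * Z) + 40 * sh := by positivity
    calc C ^ 2 * a * (20 * sh) ^ (2 * η) * (8 * Real.sqrt (10 * (h : ℝ) * Z) + 40 * sh)
        ≤ C ^ 2 * a * (20 * X ^ (2 * η)) * (66 * Real.sqrt ((h : ℝ) * Z)) :=
          mul_le_mul (mul_le_mul_of_nonneg_left h1 (by positivity)) h2 h3 (by positivity)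
      _ = 1320 * C ^ 2 * a * X ^ (2 * η) * Real.sqrt ((h : ℝ) * Z) := by ring
  -- (b5) far: `≤ (144(1+13/η) + 720) C² a X^{3η} √(hZ)`
  have hb5 : C ^ 2 * a * ((2 + 4 * Z) * (2 * sh)) ^ (2 * η) *
      (12 * Real.sqrt ((h : ℝ) * Z) * (1 + Real.log ((2 + 4 * Z) * (2 * sh) + 1)) +
        12 * Real.sqrt (2 * sh) * Real.sqrt ((2 + 4 * Z) * (2 * sh))) ≤
      (144 * (1 + 13 / η) + 720) * C ^ 2 * a * X ^ (3 * η) * Real.sqrt ((h : ℝ) * Z) := by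
    set Mst : ℝ := (2 + 4 * Z) * (2 * sh) with hMst
    have hMst0 : 0 ≤ Mst := by positivity
    have hMstX : Mst ≤ 12 * X := by
      have : (2 + 4 * Z) * (2 * sh) ≤ 6 * Z * (2 * sh) := by nlinarith
      rw [hMst]; nlinarith
    have h1 : Mst ^ (2 * η) ≤ 12 * X ^ (2 * η) := by
      have h0 : Mst ≤ 12 * X ^ (1 : ℝ) := by rw [Real.rpow_one]; exact hMstX
      have h2η : 0 ≤ 2 * η := by linarith
      have := rpow_le_of_le_mul_rpow hMst0 hX1 (by norm_num) h0 h2η (by linarith)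
      rwa [one_mul] at this
    have h2 : 1 + Real.log (Mst + 1) ≤ (1 + 13 / η) * X ^ η := by
      have hl : Real.log (Mst + 1) ≤ (Mst + 1) ^ η / η := Real.log_le_rpow_div (by positivity) hη0
      have hp : (Mst + 1) ^ η ≤ 13 * X ^ η := by
        have h0 : Mst + 1 ≤ 13 * X ^ (1 : ℝ) := by rw [Real.rpow_one]; linarith
        have := rpow_le_of_le_mul_rpow (by positivity) hX1 (by norm_num) h0 hη0.le (by linarith)
        rwa [one_mul] at this
      have hX1η : 1 ≤ X ^ η := Real.one_le_rpow hX1 hη0.le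
      have : (Mst + 1) ^ η / η ≤ 13 * X ^ η / η := div_le_div_of_nonneg_right hp hη0.le
      rw [add_mul, one_mul, div_mul_eq_mul_div]
      have : 13 * X ^ η / η = 13 / η * X ^ η := by ring
      linarith
    have h3 : Real.sqrt (2 * sh) * Real.sqrt Mst ≤ 5 * Real.sqrt ((h : ℝ) * Z) := by
      rw [← Real.sqrt_mul (by positivity), hsqrthZ]
      have hprod : 2 * sh * Mst ≤ 24 * (sh ^ 2 * Z) := by
        rw [hMst]; nlinarith
      calc Real.sqrt (2 * sh * Mst) ≤ Real.sqrt (24 * (sh ^ 2 * Z)) := Real.sqrt_le_sqrt hprod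
        _ = Real.sqrt 24 * (sh * Real.sqrt Z) := by
            rw [Real.sqrt_mul (by norm_num), Real.sqrt_mul (by positivity), Real.sqrt_sq (by positivity)]
        _ ≤ 5 * (sh * Real.sqrt Z) := by
            refine mul_le_mul_of_nonneg_right ?_ (by positivity)
            rw [Real.sqrt_le_left (by norm_num)]; norm_num
    have hlog0 : 0 ≤ 1 + Real.log (Mst + 1) := by
      have : 0 ≤ Real.log (Mst + 1) := Real.log_nonneg (by linarith)
      linarith
    have hXη3 : X ^ (2 * η) * X ^ η = X ^ (3 * η) := by
      rw [← Real.rpow_add hX0]; ring_nf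
    have hin : 12 * Real.sqrt ((h : ℝ) * Z) * (1 + Real.log (Mst + 1)) + 12 * Real.sqrt (2 * sh) * Real.sqrt Mst ≤
        (12 * (1 + 13 / η) * X ^ η + 60) * Real.sqrt ((h : ℝ) * Z) := by
      have e1 : 12 * Real.sqrt ((h : ℝ) * Z) * (1 + Real.log (Mst + 1)) ≤
          12 * Real.sqrt ((h : ℝ) * Z) * ((1 + 13 / η) * X ^ η) := mul_le_mul_of_nonneg_left h2 (by positivity)
      have e2 : 12 * Real.sqrt (2 * sh) * Real.sqrt Mst ≤ 12 * (5 * Real.sqrt ((h : ℝ) * Z)) := by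
        rw [mul_assoc]; exact mul_le_mul_of_nonneg_left h3 (by norm_num)
      nlinarith
    have hin' : (12 * (1 + 13 / η) * X ^ η + 60) ≤ (12 * (1 + 13 / η) + 60) * X ^ η := by
      have : 1 ≤ X ^ η := Real.one_le_rpow hX1 hη0.le
      nlinarith [show (0:ℝ) ≤ 12 * (1 + 13 / η) by positivity]
    calc C ^ 2 * a * Mst ^ (2 * η) *
          (12 * Real.sqrt ((h : ℝ) * Z) * (1 + Real.log (Mst + 1)) + 12 * Real.sqrt (2 * sh) * Real.sqrt Mst)
        ≤ C ^ 2 * a * (12 * X ^ (2 * η)) * ((12 * (1 + 13 / η) * X ^ η + 60) * Real.sqrt ((h : ℝ) * Z)) :=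
          mul_le_mul (mul_le_mul_of_nonneg_left h1 (by positivity)) hin (by positivity) (by positivity)
      _ ≤ C ^ 2 * a * (12 * X ^ (2 * η)) * (((12 * (1 + 13 / η) + 60) * X ^ η) * Real.sqrt ((h : ℝ) * Z)) :=
          mul_le_mul_of_nonneg_left (mul_le_mul_of_nonneg_right hin' hsZ0) (by positivity)
      _ = (144 * (1 + 13 / η) + 720) * C ^ 2 * a * (X ^ (2 * η) * X ^ η) * Real.sqrt ((h : ℝ) * Z) := by ring
      _ = (144 * (1 + 13 / η) + 720) * C ^ 2 * a * X ^ (3 * η) * Real.sqrt ((h : ℝ) * Z) := by rw [hXη3]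
  -- combine: F ≤ Kf C² a X^{3η} √(hZ)
  have hF : C ^ 2 * a * (20 * sh) ^ (2 * η) * (8 * Real.sqrt (10 * (h : ℝ) * Z) + 40 * sh) +
      C ^ 2 * a * ((2 + 4 * Z) * (2 * sh)) ^ (2 * η) *
        (12 * Real.sqrt ((h : ℝ) * Z) * (1 + Real.log ((2 + 4 * Z) * (2 * sh) + 1)) +
          12 * Real.sqrt (2 * sh) * Real.sqrt ((2 + 4 * Z) * (2 * sh))) ≤
      Kf * C ^ 2 * a * X ^ (3 * η) * Real.sqrt ((h : ℝ) * Z) := by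
    have h23 : X ^ (2 * η) ≤ X ^ (3 * η) := hXmono (by linarith)
    have e1 : 1320 * C ^ 2 * a * X ^ (2 * η) * Real.sqrt ((h : ℝ) * Z) ≤
        1320 * C ^ 2 * a * X ^ (3 * η) * Real.sqrt ((h : ℝ) * Z) :=
      mul_le_mul_of_nonneg_right (mul_le_mul_of_nonneg_left h23 (by positivity)) hsZ0
    calc _ ≤ 1320 * C ^ 2 * a * X ^ (3 * η) * Real.sqrt ((h : ℝ) * Z) +
          (144 * (1 + 13 / η) + 720) * C ^ 2 * a * X ^ (3 * η) * Real.sqrt ((h : ℝ) * Z) :=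
          add_le_add (hb4.trans e1) hb5
      _ = Kf * C ^ 2 * a * X ^ (3 * η) * Real.sqrt ((h : ℝ) * Z) := by rw [hKf]; ring
  -- the three factors
  set R := 3 * C ^ 2 * a * (2 * sh + 1) ^ (1 + 2 * η) with hR
  set Lb := C ^ 3 * (Q : ℝ) ^ (3 * η) * a ^ 2 with hLb
  set P := C * (16 * (h : ℝ) ^ 2 * Z * (Z + 1)) ^ η with hP
  set F := C ^ 2 * a * (20 * sh) ^ (2 * η) * (8 * Real.sqrt (10 * (h : ℝ) * Z) + 40 * sh) +
      C ^ 2 * a * ((2 + 4 * Z) * (2 * sh)) ^ (2 * η) *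
        (12 * Real.sqrt ((h : ℝ) * Z) * (1 + Real.log ((2 + 4 * Z) * (2 * sh) + 1)) +
          12 * Real.sqrt (2 * sh) * Real.sqrt ((2 + 4 * Z) * (2 * sh))) with hFdef
  have hR0 : 0 ≤ R := by positivity
  have hP0 : 0 ≤ P := by positivity
  have hF0 : 0 ≤ F := by
    have hlog : 0 ≤ 1 + Real.log ((2 + 4 * Z) * (2 * sh) + 1) := by
      have : 0 ≤ Real.log ((2 + 4 * Z) * (2 * sh) + 1) := Real.log_nonneg (by nlinarith)
      linarith
    positivity
  have hinner : (Q : ℝ) + P * F ≤ (Q : ℝ) + 32 * Kf * C ^ 3 * a * X ^ (5 * η) * Real.sqrt ((h : ℝ) * Z) := by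
    have hX5 : X ^ (2 * η) * X ^ (3 * η) = X ^ (5 * η) := by rw [← Real.rpow_add hX0]; ring_nf
    have : P * F ≤ (C * (32 * X ^ (2 * η))) * (Kf * C ^ 2 * a * X ^ (3 * η) * Real.sqrt ((h : ℝ) * Z)) :=
      mul_le_mul hb3 hF hF0 (by positivity)
    calc (Q : ℝ) + P * F ≤ (Q : ℝ) + (C * (32 * X ^ (2 * η))) * (Kf * C ^ 2 * a * X ^ (3 * η) * Real.sqrt ((h : ℝ) * Z)) := by
          linarith
      _ = (Q : ℝ) + 32 * Kf * C ^ 3 * a * (X ^ (2 * η) * X ^ (3 * η)) * Real.sqrt ((h : ℝ) * Z) := by ring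
      _ = _ := by rw [hX5]
  have hinner0 : 0 ≤ (Q : ℝ) + P * F := by positivity
  -- final
  have hX4 : X ^ η * X ^ (3 * η) = X ^ (4 * η) := by rw [← Real.rpow_add hX0]; ring_nf
  have hX9 : X ^ (4 * η) * X ^ (5 * η) = X ^ (9 * η) := by rw [← Real.rpow_add hX0]; ring_nf
  have hX49 : X ^ (4 * η) ≤ X ^ (9 * η) := hXmono (by linarith)
  have hX9ε : X ^ (9 * η) ≤ X ^ ε := hXmono h9η
  have hshsZ : sh * Real.sqrt ((h : ℝ) * Z) = (h : ℝ) * Real.sqrt Z := by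
    rw [hsqrthZ, ← mul_assoc, ← pow_two, hsh2]
  calc R * (Lb * ((Q : ℝ) + P * F))
      ≤ (27 * C ^ 2 * a * sh * X ^ η) * ((C ^ 3 * X ^ (3 * η) * a ^ 2) *
          ((Q : ℝ) + 32 * Kf * C ^ 3 * a * X ^ (5 * η) * Real.sqrt ((h : ℝ) * Z))) :=
        mul_le_mul hb1 (mul_le_mul hb2 hinner hinner0 (by positivity)) (by positivity) (by positivity)
    _ = 27 * C ^ 5 * a ^ 3 * (X ^ η * X ^ (3 * η)) * ((Q : ℝ) * sh) +
          27 * 32 * Kf * C ^ 8 * a ^ 4 * ((X ^ η * X ^ (3 * η)) * X ^ (5 * η)) * (sh * Real.sqrt ((h : ℝ) * Z)) := by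
        ring
    _ = 27 * C ^ 5 * a ^ 3 * X ^ (4 * η) * ((Q : ℝ) * sh) +
          864 * Kf * C ^ 8 * a ^ 4 * X ^ (9 * η) * ((h : ℝ) * Real.sqrt Z) := by
        rw [hX4, hX9, hshsZ]; ring
    _ ≤ 864 * Kf * C ^ 8 * a ^ 4 * X ^ ε * ((Q : ℝ) * sh) +
          864 * Kf * C ^ 8 * a ^ 4 * X ^ ε * ((h : ℝ) * Real.sqrt Z) := by
        have hQsh : 0 ≤ (Q : ℝ) * sh := by positivity
        have hhZ' : 0 ≤ (h : ℝ) * Real.sqrt Z := by positivity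
        refine add_le_add (mul_le_mul_of_nonneg_right ?_ hQsh) (mul_le_mul_of_nonneg_right ?_ hhZ')
        · -- `27 C⁵ a³ X^{4η} ≤ 864 Kf C⁸ a⁴ X^ε`
          have h1 : X ^ (4 * η) ≤ X ^ ε := hX49.trans hX9ε
          have h2 : (27 : ℝ) * C ^ 5 * a ^ 3 ≤ 864 * Kf * C ^ 8 * a ^ 4 := by
            have hC3 : (1 : ℝ) ≤ C ^ 3 := one_le_pow₀ hC1
            have hKf1 : (1 : ℝ) ≤ Kf := by
              have h144 : (0:ℝ) ≤ 144 * (1 + 13 / η) := by positivity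
              rw [hKf]; linarith
            have : (27 : ℝ) * C ^ 5 * a ^ 3 * 1 * 1 * 1 ≤ 864 * C ^ 5 * a ^ 3 * Kf * C ^ 3 * a := by
              gcongr; norm_num
            linarith
          exact mul_le_mul h2 h1 (by positivity) (by positivity)
        · exact mul_le_mul_of_nonneg_left hX9ε (by positivity)
    _ = 864 * Kf * C ^ 8 * (a : ℝ) ^ 4 * X ^ ε * ((Q : ℝ) * sh + (h : ℝ) * Real.sqrt Z) := by ring

end assembly

end GM2025

end Literature.NumberTheory.Sieve

end
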